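import Summits.AtomisticToContinuum.Crystallization.Theorems.FrustratedLawDichotomyStrainedPatchHomValueT2SoundZ

/-!
# (I1) ★★★ `valueLeafT2T_sound` — soundness of the value leaf at the AFFINE TRACK (`…HomValueT2Track` §13; critic row 1674 (B) docket item 2)

The track verdict `valueLeafT2T μ c w aP` ⟹ `(μ − 1)/SC ≤ E(U, ξ)` for every self-adjoint `U` in the box `(c, w)` and the track point
`ξ_m = c_m/SC + Σ_e (aP m e/SC)·t_e(U)` (`t = dispN (U − U_c) 0`): `valueLeafT2J_sound`'s assembly on the track box `trackW aP w`, with the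
quadratic model read through the graph identities of `…SoundZ`.  No definitions; 0 sorry; standard axioms.  `--supports stmt-AtomisticToContinuum-27623`.
-/

noncomputable section

namespace Summit.AtomisticToContinuum.Crystallization.Theorems.FrustratedLawDichotomyStrainedPatchHomValueT2Kit

open scoped BigOperators RealInnerProductSpace
open Finset
open Literature.Analysis.ValidatedNumerics.Numerics
open Summit.AtomisticToContinuum.Crystallization.Theorems.ChargedEnergyGapNegative (E3)
open Summit.AtomisticToContinuum.Crystallization.Theorems.FrustratedLawDichotomySchurCut (effPot w₄₅ ω₄)
open Summit.AtomisticToContinuum.Crystallization.Theorems.FrustratedLawDichotomyStrainedPatchTaylorLeaves (junctions)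
open Summit.AtomisticToContinuum.Crystallization.Theorems.FrustratedLawDichotomyStrainedPatchHomSplit (latPt hexFrame hcpShift)
open Summit.AtomisticToContinuum.Crystallization.Theorems.FrustratedLawDichotomyStrainedPatchHomEntryGram (cen rad abs_sub_cen_le)
open Summit.AtomisticToContinuum.Crystallization.Theorems.FrustratedLawDichotomyStrainedPatchHomEntryGramHcp (shufFI)
open Summit.AtomisticToContinuum.Crystallization.Theorems.FrustratedLawDichotomyStrainedPatchHomCurvCentreKit (boxE cenE cenX cenMap cenShuf cenShuf_apply)

/-! ## §1. The track verdict unpacked; the track point lies in the track box -/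

/-- ★ The track verdict unpacked (`t2TrackCore` with `valueP`). [formal bookkeeping] -/
theorem of_valueLeafT2T {μ : ℤ} {c w : (Fin 3 × Fin 3) ⊕ Fin 3 → ℤ} {aP : Fin 3 → Fin 6 → ℤ} (h : valueLeafT2T μ c w aP = true) :
    ∃ v κ : ℤ, valueP μ c = some v ∧ kappaShift ((hessTrack aP (passP c (nearA c (trackW aP w)) (nearB c (trackW aP w))).H).map cen) = some κ ∧ foldGuard c (trackW aP w) = true ∧ (passP c (nearA c (trackW aP w)) (nearB c (trackW aP w))).ok = true ∧ (passJ c (trackW aP w) (Array.ofFn fun p : Fin 9 => foldW (trackW aP w) p) (nearA c (trackW aP w)) (nearB c (trackW aP w))).ok = true ∧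
      symOK ((hessTrack aP (passP c (nearA c (trackW aP w)) (nearB c (trackW aP w))).H).map cen) = true ∧
      0 ≤ v + boxMin ((hessTrack aP (passP c (nearA c (trackW aP w)) (nearB c (trackW aP w))).H).map cen) ((gradTrack aP (passP c (nearA c (trackW aP w)) (nearB c (trackW aP w))).g).map cen) (wfU (Array.ofFn fun p : Fin 9 => foldW (trackW aP w) p)) κ (anchor ((hessTrack aP (passP c (nearA c (trackW aP w)) (nearB c (trackW aP w))).H).map cen) ((gradTrack aP (passP c (nearA c (trackW aP w)) (nearB c (trackW aP w))).g).map cen) (wfU (Array.ofFn fun p : Fin 9 => foldW (trackW aP w) p)) 40) - (cdiv ((List.range 9).foldl (fun s k => s + ((gradTrack aP (passP c (nearA c (trackW aP w)) (nearB c (trackW aP w))).g).map rad).getD k 0 * (wfU (Array.ofFn fun p : Fin 9 => foldW (trackW aP w) p)).getD k 0) 0) (SC : ℤ) + cdiv ((List.range 9).foldl (fun s k => (List.range 9).foldl (fun s2 l => s2 + (((hessTrack aP (passP c (nearA c (trackW aP w)) (nearB c (trackW aP w))).H).map rad).getD (9 * k + l) 0) * (wfU (Array.ofFn fun p : Fin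 9 => foldW (trackW aP w) p)).getD k 0 * (wfU (Array.ofFn fun p : Fin 9 => foldW (trackW aP w) p)).getD l 0) s) 0) (2 * (SC : ℤ) * (SC : ℤ))) - cdiv (passJ c (trackW aP w) (Array.ofFn fun p : Fin 9 => foldW (trackW aP w) p) (nearA c (trackW aP w)) (nearB c (trackW aP w))).pen6 (6 * (SC : ℤ) * (SC : ℤ)) - cdiv (passJ c (trackW aP w) (Array.ofFn fun p : Fin 9 => foldW (trackW aP w) p) (nearA c (trackW aP w)) (nearB c (trackW aP w))).pen0 (2 * (SC : ℤ) * (SC : ℤ)) - μ := by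
  unfold valueLeafT2T t2ReportT t2TrackCore at h
  simp only [Bool.and_eq_true, decide_eq_true_eq] at h
  obtain ⟨h1, h2⟩ := h
  cases hv : valueP μ c with
  | none => simp [hv] at h1
  | some v =>
    cases hκ : kappaShift ((hessTrack aP (passP c (nearA c (trackW aP w)) (nearB c (trackW aP w))).H).map cen) with
    | none => simp [hv, hκ] at h1
    | some κ =>
      simp only [hv, hκ, Bool.and_eq_true] at h1 h2
      obtain ⟨⟨⟨hg, hP⟩, hA⟩, hs⟩ := h1
      exact ⟨v, κ, rfl, rfl, hg, hP, hA, hs, h2⟩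

/-- The drift sum dominates the track displacement: `|Σ_e (aP m e/SC)·t_e| ≤ driftW/SC` when `|t_e| ≤ w_e/SC`. [arithmetic] -/
theorem abs_track_le (aP : Fin 3 → Fin 6 → ℤ) (w : (Fin 3 × Fin 3) ⊕ Fin 3 → ℤ) (m : Fin 3) (t : ℕ → ℝ)
    (ht : ∀ e : Fin 6, |t e| ≤ (foldW w ⟨e, by omega⟩ : ℝ) / SC) :
    |∑ e : Fin 6, ((aP m e : ℤ) : ℝ) / SC * t e| ≤ (driftW aP w m : ℝ) / SC := by
  have hS := SC_pos
  have hfold : ((List.range 6).foldl (fun s e => if he : e < 6 then s + |aP m ⟨e, he⟩| * foldW w ⟨e, by omega⟩ else s) 0 : ℤ) =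
      ∑ e : Fin 6, |aP m e| * foldW w ⟨e, by omega⟩ := by
    simp [List.range, List.range.loop, List.foldl, Fin.sum_univ_six]
  have h1 : |∑ e : Fin 6, ((aP m e : ℤ) : ℝ) / SC * t e| ≤ ∑ e : Fin 6, (|((aP m e : ℤ) : ℝ)| * (foldW w ⟨e, by omega⟩ : ℝ)) / ((SC : ℝ) * SC) := by
    refine (Finset.abs_sum_le_sum_abs _ _).trans (Finset.sum_le_sum fun e _ => ?_)
    rw [abs_mul, abs_div, abs_of_pos hS, le_div_iff₀ (mul_pos hS hS)]
    have := ht e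
    have h2 : |t e| * SC ≤ foldW w ⟨e, by omega⟩ := (le_div_iff₀ hS).1 this
    have : |((aP m e : ℤ) : ℝ)| / SC * |t e| * (SC * SC) = |((aP m e : ℤ) : ℝ)| * (|t e| * SC) := by field_simp
    rw [this]
    exact mul_le_mul_of_nonneg_left h2 (abs_nonneg _)
  refine h1.trans ?_
  rw [← Finset.sum_div, div_le_div_iff₀ (mul_pos hS hS) hS]
  have hc : ((∑ e : Fin 6, |aP m e| * foldW w ⟨e, by omega⟩ : ℤ) : ℝ) ≤ (driftW aP w m : ℝ) * SC := by
    have hd : ((∑ e : Fin 6, |aP m e| * foldW w ⟨e, by omega⟩ : ℤ) : ℝ) / SC ≤ ((cdiv (∑ e : Fin 6, |aP m e| * foldW w ⟨e, by omega⟩) (SC : ℤ) : ℤ) : ℝ) := by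
      have := div_le_cdiv (a := ∑ e : Fin 6, |aP m e| * foldW w ⟨e, by omega⟩) (b := (SC : ℤ)) SCZ_pos
      push_cast at this ⊢
      exact this
    have hmax : ((cdiv (∑ e : Fin 6, |aP m e| * foldW w ⟨e, by omega⟩) (SC : ℤ) : ℤ) : ℝ) ≤ (driftW aP w m : ℝ) := by
      unfold driftW; rw [hfold]; exact_mod_cast le_max_right _ _
    have := (div_le_iff₀ hS).1 (hd.trans hmax)
    exact this
  push_cast at hc
  nlinarith [hc, hS]

/-- The graph identity of the affine track in folded coordinates: `δ_{6+m} = Σ_{e<6} (aP m e/SC)·δ_e`. [formal bookkeeping] -/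
theorem track_graph {c : (Fin 3 × Fin 3) ⊕ Fin 3 → ℤ} (aP : Fin 3 → Fin 6 → ℤ) (U : E3 →L[ℝ] E3) (ξ : E3)
    (hξσ : ∀ m : Fin 3, ξ m = (c (Sum.inr m) : ℝ) / SC + ∑ e : Fin 6, ((aP m e : ℤ) : ℝ) / SC * dispN (U - cenMap c) 0 e) {m : ℕ} (hm : m < 3) :
    dispN (U - cenMap c) (ξ - cenShuf c) (6 + m) = ∑ e ∈ range 6, (fun m e : ℕ => if he : e < 6 then ((aP ⟨m % 3, Nat.mod_lt _ (by norm_num)⟩ ⟨e, he⟩ : ℤ) : ℝ) / SC else 0) m e * dispN (U - cenMap c) (ξ - cenShuf c) e := by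
  have ex : ∀ e ∈ range 6, (fun m e : ℕ => if he : e < 6 then ((aP ⟨m % 3, Nat.mod_lt _ (by norm_num)⟩ ⟨e, he⟩ : ℤ) : ℝ) / SC else 0) m e * dispN (U - cenMap c) (ξ - cenShuf c) e = (fun m e : ℕ => if he : e < 6 then ((aP ⟨m % 3, Nat.mod_lt _ (by norm_num)⟩ ⟨e, he⟩ : ℤ) : ℝ) / SC else 0) m e * dispN (U - cenMap c) 0 e := fun e he => by
    rw [dispN_xi_zero _ (ξ - cenShuf c) (by have := Finset.mem_range.1 he; omega), if_pos (Finset.mem_range.1 he)]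
  rw [Finset.sum_congr rfl ex, Finset.sum_range]
  have f62 : (⟨2, by norm_num⟩ : Fin 6) = 2 := rfl
  have f63 : (⟨3, by norm_num⟩ : Fin 6) = 3 := rfl
  have f64 : (⟨4, by norm_num⟩ : Fin 6) = 4 := rfl
  have f65 : (⟨5, by norm_num⟩ : Fin 6) = 5 := rfl
  have f32 : (⟨2, by norm_num⟩ : Fin 3) = 2 := rfl
  interval_cases m
  · simp only [dispN, PiLp.sub_apply, cenShuf_apply, hξσ 0, Fin.sum_univ_six]; norm_num [f62, f63, f64, f65]
  · simp only [dispN, PiLp.sub_apply, cenShuf_apply, hξσ 1, Fin.sum_univ_six]; norm_num [f62, f63, f64, f65]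
  · simp only [dispN, PiLp.sub_apply, cenShuf_apply, hξσ 2, Fin.sum_univ_six]; norm_num [f62, f63, f64, f65, f32]

/-- The masked `9 × 9` quadratic form in `x = dispN ΔU 0` is the `6 × 6` form in `δ = dispN ΔU Δξ`. [formal bookkeeping] -/
theorem sum99_dite_eq (ΔU : E3 →L[ℝ] E3) (Δξ : E3) (F : ℕ → ℕ → ℝ) :
    ∑ k ∈ range 9, ∑ l ∈ range 9, (if k < 6 then (if l < 6 then F k l else 0) else 0) * (dispN ΔU 0 k * dispN ΔU 0 l) =
      ∑ k ∈ range 6, ∑ l ∈ range 6, F k l * (dispN ΔU Δξ k * dispN ΔU Δξ l) := by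
  have e : ∑ k ∈ range 6, ∑ l ∈ range 6, F k l * (dispN ΔU Δξ k * dispN ΔU Δξ l) =
      ∑ k ∈ range 6, ∑ l ∈ range 6, F k l * (dispN ΔU 0 k * dispN ΔU 0 l) :=
    Finset.sum_congr rfl fun k hk => Finset.sum_congr rfl fun l hl => by
      have hk6 := Finset.mem_range.1 hk; have hl6 := Finset.mem_range.1 hl
      rw [dispN_xi_zero ΔU Δξ (k := k) (by omega), dispN_xi_zero ΔU Δξ (k := l) (by omega), if_pos hk6, if_pos hl6]
  rw [e, sum66_disp0 ΔU 0]
  refine Finset.sum_congr rfl fun k _ => Finset.sum_congr rfl fun l _ => ?_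
  by_cases hk6 : k < 6
  · by_cases hl6 : l < 6
    · rw [if_pos hk6, if_pos hl6, if_pos ⟨hk6, hl6⟩]
    · rw [if_pos hk6, if_neg hl6, if_neg (fun h => hl6 h.2)]
  · rw [if_neg hk6, if_neg (fun h => hk6 h.1)]

/-- The near-label counts pay for the `729·SC` ulp terms: `(#A + #B)·729·SC ≤ 6·SC²`. [arithmetic] -/
theorem cards729_le (c w : (Fin 3 × Fin 3) ⊕ Fin 3 → ℤ) :
    (((nearA c w).toFinset.card : ℕ) : ℝ) * (729 * SC) + (((nearB c w).toFinset.card : ℕ) : ℝ) * (729 * SC) ≤ 6 * SC * SC := by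
  have hS := SC_pos
  have hSC : (4920750 : ℝ) ≤ SC := by norm_num [SC]
  have hcardA : (((nearA c w).toFinset.card : ℕ) : ℝ) ≤ 3375 := by
    exact_mod_cast (List.toFinset_card_le _).trans (length_near_le c w).1
  have hcardB : (((nearB c w).toFinset.card : ℕ) : ℝ) ≤ 3375 := by
    exact_mod_cast (List.toFinset_card_le _).trans (length_near_le c w).2
  have h729 : (0 : ℝ) ≤ 729 * SC := by linarith
  have hA' := mul_le_mul_of_nonneg_right hcardA h729
  have hB' := mul_le_mul_of_nonneg_right hcardB h729
  have hSS := mul_le_mul_of_nonneg_right hSC hS.le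
  linarith [hA', hB', hSS, mul_pos hS hS]

/-! ## §2. ★★★ The theorem -/
set_option maxHeartbeats 400000 in
/-- ★★★ **SOUNDNESS OF THE TRACK VALUE LEAF** (`(I1)` for `…HomValueT2Track.valueLeafT2T`): verdict ⟹ `(μ − 1)/SC ≤ E(U, σ U)` for every self-adjoint
`U` in the box, `σ` the affine track. [folklore chaining: `valueLeafT2J_sound`'s assembly through the graph identities] -/
theorem valueLeafT2T_sound {μ : ℤ} {c w : (Fin 3 × Fin 3) ⊕ Fin 3 → ℤ} {aP : Fin 3 → Fin 6 → ℤ} (hleaf : valueLeafT2T μ c w aP = true)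
    (hU1 : ‖cenMap c - 1‖ ≤ 1 / 4) (hw_inr : ∀ m : Fin 3, 0 ≤ w (Sum.inr m)) (hw1 : ∀ p : Fin 9, foldW (trackW aP w) p ≤ (SC : ℤ))
    (U : E3 →L[ℝ] E3) (ξ : E3) (hsa : ∀ v v' : E3, ⟪U v, v'⟫ = ⟪v, U v'⟫)
    (hbox : ∀ ab : Fin 3 × Fin 3, |(U (EuclideanSpace.single ab.2 (1 : ℝ))) ab.1 - (c (Sum.inl ab) : ℝ) / SC| ≤ (w (Sum.inl ab) : ℝ) / SC)
    (hξσ : ∀ m : Fin 3, ξ m = (c (Sum.inr m) : ℝ) / SC + ∑ e : Fin 6, ((aP m e : ℤ) : ℝ) / SC * dispN (U - cenMap c) 0 e)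
    (hJA : ∀ b ∈ nearA c (trackW aP w), ‖latPt (cenMap c) hexFrame b‖ ∉ junctions)
    (hJB : ∀ b ∈ nearB c (trackW aP w), ‖latPt (cenMap c) hexFrame b + cenMap c (hcpShift + cenShuf c)‖ ∉ junctions) :
    ((μ : ℝ) - 1) / SC ≤
      (∑ b ∈ (Fintype.piFinset fun _ : Fin 3 => Finset.Icc (-7 : ℤ) 7).filter (fun b => b ≠ 0), effPot w₄₅ ω₄ (3 / 400) ‖latPt U hexFrame b‖) +
        ∑ b ∈ (Fintype.piFinset fun _ : Fin 3 => Finset.Icc (-7 : ℤ) 7), effPot w₄₅ ω₄ (3 / 400) ‖latPt U hexFrame b + U (hcpShift + ξ)‖ := by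
  classical
  have hS := SC_pos
  have hS3 : (0 : ℝ) < ((SC : ℝ) * SC * SC) := by positivity
  obtain ⟨v, κ, hvP, hκ, hfg, hPok, hAok, hsymOK, hineq⟩ := of_valueLeafT2T hleaf
  obtain ⟨hc, hwpos⟩ := of_foldGuard hfg
  -- the box `(c, trackW aP w)`: entries as in `w`, the track point inside the widened shuffle box
  have hbox' : ∀ ab : Fin 3 × Fin 3, |(U (EuclideanSpace.single ab.2 (1 : ℝ))) ab.1 - (c (Sum.inl ab) : ℝ) / SC| ≤ ((trackW aP w) (Sum.inl ab) : ℝ) / SC :=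
    fun ab => hbox ab
  have hδU : ∀ k (hk : k < 9), |dispN (U - cenMap c) 0 k| ≤ (foldW (trackW aP w) ⟨k, hk⟩ : ℝ) / SC := by
    intro k hk
    have h := abs_dispN_le (c := c) (w := (trackW aP w)) U (cenShuf c) hsa hc hbox' (fun i => by
      rw [cenShuf_apply, sub_self, abs_zero]; exact div_nonneg (w_inr_nonneg hwpos i) hS.le) k hk
    rw [sub_self] at h
    exact h
  have hξ : ∀ i : Fin 3, |ξ i - (c (Sum.inr i) : ℝ) / SC| ≤ ((trackW aP w) (Sum.inr i) : ℝ) / SC := by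
    intro i
    rw [hξσ i, add_sub_cancel_left]
    have h := abs_track_le aP (trackW aP w) i (dispN (U - cenMap c) 0) (fun e => hδU e (by omega))
    refine h.trans ?_
    have e1 : ((trackW aP w) (Sum.inr i) : ℤ) = w (Sum.inr i) + driftW aP w i := rfl
    have e2 : driftW aP (trackW aP w) i = driftW aP w i := by unfold driftW; rfl
    rw [e2, e1]; push_cast
    have := hw_inr i
    have : (0 : ℝ) ≤ w (Sum.inr i) := by exact_mod_cast this
    exact div_le_div_of_nonneg_right (by linarith) hS.le
  rw [boxSumA_eq_nearSum U hbox', boxSumB_eq_nearSum U hbox' ξ hξ]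
  -- records of both passes (as functions of the label)
  obtain ⟨hrecA, hrecB, hpen6, hpen0⟩ := passJ_spec c (trackW aP w) (Array.ofFn fun p : Fin 9 => foldW (trackW aP w) p) (nearA c (trackW aP w)) (nearB c (trackW aP w)) hAok
  obtain ⟨hPA, hPB, hPH, hPg⟩ := passP_spec c (nearA c (trackW aP w)) (nearB c (trackW aP w)) hPok
  obtain ⟨RbA, hRbA⟩ : ∃ RbA : (Fin 3 → ℤ) → DRec, ∀ b ∈ nearA c (trackW aP w), mkDRec 6 (boxE c (trackW aP w)) (pA b) = some (RbA b) :=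
    ⟨fun b => (mkDRec 6 (boxE c (trackW aP w)) (pA b)).getD ⟨fun _ => fi0, #[], #[], #[], ⟨fi0, fi0, fi0, false⟩, #[], #[]⟩, fun b hb => by
      obtain ⟨Rb, Rp, h1, _⟩ := hrecA b hb; simp [h1]⟩
  obtain ⟨RpA, hRpA⟩ : ∃ RpA : (Fin 3 → ℤ) → DRec, ∀ b ∈ nearA c (trackW aP w), mkDRec 6 (cenE c) (pA b) = some (RpA b) :=
    ⟨fun b => (mkDRec 6 (cenE c) (pA b)).getD ⟨fun _ => fi0, #[], #[], #[], ⟨fi0, fi0, fi0, false⟩, #[], #[]⟩, fun b hb => by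
      obtain ⟨Rb, Rp, _, h2⟩ := hrecA b hb; simp [h2]⟩
  obtain ⟨RbB, hRbB⟩ : ∃ RbB : (Fin 3 → ℤ) → DRec, ∀ b ∈ nearB c (trackW aP w), mkDRec 9 (boxE c (trackW aP w)) (qB (shufFI c (trackW aP w)) b) = some (RbB b) :=
    ⟨fun b => (mkDRec 9 (boxE c (trackW aP w)) (qB (shufFI c (trackW aP w)) b)).getD ⟨fun _ => fi0, #[], #[], #[], ⟨fi0, fi0, fi0, false⟩, #[], #[]⟩, fun b hb => by
      obtain ⟨Rb, Rp, h1, _⟩ := hrecB b hb; simp [h1]⟩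
  obtain ⟨RpB, hRpB⟩ : ∃ RpB : (Fin 3 → ℤ) → DRec, ∀ b ∈ nearB c (trackW aP w), mkDRec 9 (cenE c) (qB (cenX c) b) = some (RpB b) :=
    ⟨fun b => (mkDRec 9 (cenE c) (qB (cenX c) b)).getD ⟨fun _ => fi0, #[], #[], #[], ⟨fi0, fi0, fi0, false⟩, #[], #[]⟩, fun b hb => by
      obtain ⟨Rb, Rp, _, h2⟩ := hrecB b hb; simp [h2]⟩
  -- half-widths and displacements
  have hwf0 : ∀ k, 0 ≤ (Array.ofFn fun p : Fin 9 => foldW (trackW aP w) p).getD k 0 := wfA_nonneg hwpos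
  have hwf1 : ∀ k, (Array.ofFn fun p : Fin 9 => foldW (trackW aP w) p).getD k 0 ≤ (SC : ℤ) := wfA_le (by positivity) hw1
  have hδ : ∀ k, k < 9 → |dispN (U - cenMap c) (ξ - cenShuf c) k| ≤ (((Array.ofFn fun p : Fin 9 => foldW (trackW aP w) p).getD k 0 : ℤ) : ℝ) / SC :=
    fun k hk => by rw [wfA_getD (trackW aP w) hk]; exact abs_dispN_le U ξ hsa hc hbox' hξ k hk
  have hδ0 : ∀ k, k < 9 → |dispN (U - cenMap c) 0 k| ≤ |dispN (U - cenMap c) (ξ - cenShuf c) k| := fun k hk => abs_disp0_le _ _ hk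
  have hwu0 : ∀ k, 0 ≤ (wfU (Array.ofFn fun p : Fin 9 => foldW (trackW aP w) p)).getD k 0 := fun k => by rw [wfU_getD]; split_ifs; exacts [hwf0 k, le_rfl]
  have hx : ∀ k, k < 9 → |dispN (U - cenMap c) 0 k| ≤ (((wfU (Array.ofFn fun p : Fin 9 => foldW (trackW aP w) p)).getD k 0 : ℤ) : ℝ) / SC := by
    intro k hk
    rw [wfU_getD]
    by_cases hk6 : k < 6
    · rw [if_pos hk6, wfA_getD (trackW aP w) hk]; exact hδU k hk
    · rw [if_neg hk6, dispN_xi_zero _ 0 hk, if_neg hk6, abs_zero]; simp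
  -- ★ per-label floors with the class charge in `accLabel` currency, summed over the two families
  have hsumA : ∑ b ∈ (nearA c (trackW aP w)).toFinset, (effPot w₄₅ ω₄ (3 / 400) ‖cenMap c (latPt (1 : E3 →L[ℝ] E3) hexFrame b)‖ + deriv (effPot w₄₅ ω₄ (3 / 400)) ‖cenMap c (latPt (1 : E3 →L[ℝ] E3) hexFrame b)‖ / ‖cenMap c (latPt (1 : E3 →L[ℝ] E3) hexFrame b)‖ * ∑ k ∈ range 6, zetaN (cenMap c) (latPt (1 : E3 →L[ℝ] E3) hexFrame b) k * dispN (U - cenMap c) 0 k + 1 / 2 * ∑ k ∈ range 6, ∑ l ∈ range 6, ((deriv (deriv (effPot w₄₅ ω₄ (3 / 400))) ‖cenMap c (latPt (1 : E3 →L[ℝ] E3) hexFrame b)‖ - deriv (effPot w₄₅ ω₄ (3 / 400)) ‖cenMap c (latPt (1 : E3 →L[ℝ] E3) hexFrame b)‖ / ‖cenMap c (latPt (1 : E3 →L[ℝ] E3) hexFrame b)‖) / ‖cenMap c (latPt (1 : E3 →L[ℝ] E3) hexFrame b)‖ ^ 2 * (zetaN (cenMap c) (latPt (1 : E3 →L[ℝ]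 E3) hexFrame b) k * zetaN (cenMap c) (latPt (1 : E3 →L[ℝ] E3) hexFrame b) l) + deriv (effPot w₄₅ ω₄ (3 / 400)) ‖cenMap c (latPt (1 : E3 →L[ℝ] E3) hexFrame b)‖ / ‖cenMap c (latPt (1 : E3 →L[ℝ] E3) hexFrame b)‖ * nuR (cenMap c) (latPt (1 : E3 →L[ℝ] E3) hexFrame b) k l) * (dispN (U - cenMap c) 0 k * dispN (U - cenMap c) 0 l) - (1 / 2 * (((accLabel wJ (fun a b : ℕ => decide (a < 6 ∧ b < 6)) (Array.ofFn fun p : Fin 9 => foldW (trackW aP w) p) (RbA b) (hessOf (RpA b) true) true ⟨true, 0, 0⟩).pen0 : ℤ) : ℝ) / ((SC : ℝ) * SC * SC) + 1 / 6 * ((((accLabel wJ (fun a b : ℕ => decide (a < 6 ∧ b < 6)) (Array.ofFn fun p : Fin 9 => foldW (trackW aP w) p) (RbA b) (hessOf (RpA b) true) true ⟨true, 0, 0⟩).pen6 : ℤ) : ℝ) + 729 * SC) / ((SC : ℝ) * SC * SC))) ≤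
      ∑ b ∈ (nearA c (trackW aP w)).toFinset, effPot w₄₅ ω₄ (3 / 400) ‖latPt U hexFrame b‖ := by
    refine Finset.sum_le_sum fun b hb => ?_
    have hb' := List.mem_toFinset.1 hb
    have h1 := floorA U hsa hc hbox' (hRbA b hb') (hRpA b hb') (hJA b hb')
    have h2 := charge_le true 6 (by simp) (fun a b : ℕ => decide (a < 6 ∧ b < 6)) (fun a b ha hb => by simp [ha, hb]) (Array.ofFn fun p : Fin 9 => foldW (trackW aP w) p) hwf0 hwf1 (RbA b) (hessOf (RpA b) true)
      (dispN (U - cenMap c) 0) (dispN (U - cenMap c) (ξ - cenShuf c)) hδ0 hδ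
    linarith
  have hsumB : ∑ b ∈ (nearB c (trackW aP w)).toFinset, (effPot w₄₅ ω₄ (3 / 400) ‖cenMap c (latPt (1 : E3 →L[ℝ] E3) hexFrame b + (hcpShift + cenShuf c))‖ + deriv (effPot w₄₅ ω₄ (3 / 400)) ‖cenMap c (latPt (1 : E3 →L[ℝ] E3) hexFrame b + (hcpShift + cenShuf c))‖ / ‖cenMap c (latPt (1 : E3 →L[ℝ] E3) hexFrame b + (hcpShift + cenShuf c))‖ * ∑ k ∈ range 9, zetaN (cenMap c) (latPt (1 : E3 →L[ℝ] E3) hexFrame b + (hcpShift + cenShuf c)) k * dispN (U - cenMap c) (ξ - cenShuf c) k + 1 / 2 * ∑ k ∈ range 9, ∑ l ∈ range 9, ((deriv (deriv (effPot w₄₅ ω₄ (3 / 400))) ‖cenMap c (latPt (1 : E3 →L[ℝ] E3) hexFrame b + (hcpShift + cenShuf c))‖ - deriv (effPot w₄₅ ω₄ (3 / 400)) ‖cenMap c (latPt (1 : E3 →L[ℝ] E3) hexFrame b + (hcpShift + cenShuf c))‖ / ‖cenMap c (latPt (1 : E3 →L[ℝ] E3) hexFrame b + (hcpShift + cenShuf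 c))‖) / ‖cenMap c (latPt (1 : E3 →L[ℝ] E3) hexFrame b + (hcpShift + cenShuf c))‖ ^ 2 * (zetaN (cenMap c) (latPt (1 : E3 →L[ℝ] E3) hexFrame b + (hcpShift + cenShuf c)) k * zetaN (cenMap c) (latPt (1 : E3 →L[ℝ] E3) hexFrame b + (hcpShift + cenShuf c)) l) + deriv (effPot w₄₅ ω₄ (3 / 400)) ‖cenMap c (latPt (1 : E3 →L[ℝ] E3) hexFrame b + (hcpShift + cenShuf c))‖ / ‖cenMap c (latPt (1 : E3 →L[ℝ] E3) hexFrame b + (hcpShift + cenShuf c))‖ * nuR (cenMap c) (latPt (1 : E3 →L[ℝ] E3) hexFrame b + (hcpShift + cenShuf c)) k l) * (dispN (U - cenMap c) (ξ - cenShuf c) k * dispN (U - cenMap c) (ξ - cenShuf c) l) - (1 / 2 * (((accLabel wJ (fun _ _ : ℕ => true) (Array.ofFn fun p : Fin 9 => foldW (trackW aP w) p) (RbB b) (hessOf (RpB b) false) false ⟨true, 0, 0⟩).pen0 : ℤ) : ℝ) / ((SC : ℝ) * SC * SC) + 1 / 6 * ((((accLabel wJ (fun _ _ : ℕ => true) (Array.ofFn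 fun p : Fin 9 => foldW (trackW aP w) p) (RbB b) (hessOf (RpB b) false) false ⟨true, 0, 0⟩).pen6 : ℤ) : ℝ) + 729 * SC) / ((SC : ℝ) * SC * SC))) ≤
      ∑ b ∈ (nearB c (trackW aP w)).toFinset, effPot w₄₅ ω₄ (3 / 400) ‖latPt U hexFrame b + U (hcpShift + ξ)‖ := by
    refine Finset.sum_le_sum fun b hb => ?_
    have hb' := List.mem_toFinset.1 hb
    have h1 := floorB U ξ hsa hc hbox' hξ (hRbB b hb') (hRpB b hb') (hJB b hb')
    have h2 := charge_le false 9 (by simp) (fun _ _ : ℕ => true) (fun _ _ _ _ => rfl) (Array.ofFn fun p : Fin 9 => foldW (trackW aP w) p) hwf0 hwf1 (RbB b) (hessOf (RpB b) false)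
      (dispN (U - cenMap c) (ξ - cenShuf c)) (dispN (U - cenMap c) (ξ - cenShuf c)) (fun _ _ => le_rfl) hδ
    linarith
  simp only [Finset.sum_add_distrib, Finset.sum_sub_distrib] at hsumA hsumB
  -- (1) the value at the centre
  have hT1 := centre_energy_ge hvP hU1 hwpos (w := (trackW aP w))
  -- the graph identity in the folded displacement
  set A : ℕ → ℕ → ℝ := (fun m e : ℕ => if he : e < 6 then ((aP ⟨m % 3, Nat.mod_lt _ (by norm_num)⟩ ⟨e, he⟩ : ℤ) : ℝ) / SC else 0) with hA
  have hgraph : ∀ m, m < 3 → dispN (U - cenMap c) (ξ - cenShuf c) (6 + m) = ∑ e ∈ range 6, A m e * dispN (U - cenMap c) (ξ - cenShuf c) e := fun m hm => by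
    simpa only [hA] using track_graph aP U ξ hξσ hm
  have hmem : ∀ k, k < 9 → FI.mem ((fun k => ((∑ b ∈ (nearA c (trackW aP w)).toFinset, (if k < 6 then deriv (effPot w₄₅ ω₄ (3 / 400)) ‖cenMap c (latPt (1 : E3 →L[ℝ] E3) hexFrame b)‖ / ‖cenMap c (latPt (1 : E3 →L[ℝ] E3) hexFrame b)‖ * zetaN (cenMap c) (latPt (1 : E3 →L[ℝ] E3) hexFrame b) k else 0)) + ∑ b ∈ (nearB c (trackW aP w)).toFinset, deriv (effPot w₄₅ ω₄ (3 / 400)) ‖cenMap c (latPt (1 : E3 →L[ℝ] E3) hexFrame b + (hcpShift + cenShuf c))‖ / ‖cenMap c (latPt (1 : E3 →L[ℝ] E3) hexFrame b + (hcpShift + cenShuf c))‖ * zetaN (cenMap c) (latPt (1 : E3 →L[ℝ] E3) hexFrame b + (hcpShift + cenShuf c)) k)) k) ((passP c (nearA c (trackW aP w)) (nearB c (trackW aP w))).g.getD k fi0) := fun k hk => by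
    have hm := hPg k hk (fun b => if k < 6 then deriv (effPot w₄₅ ω₄ (3 / 400)) ‖cenMap c (latPt (1 : E3 →L[ℝ] E3) hexFrame b)‖ / ‖cenMap c (latPt (1 : E3 →L[ℝ] E3) hexFrame b)‖ * zetaN (cenMap c) (latPt (1 : E3 →L[ℝ] E3) hexFrame b) k else 0) (fun b => deriv (effPot w₄₅ ω₄ (3 / 400)) ‖cenMap c (latPt (1 : E3 →L[ℝ] E3) hexFrame b + (hcpShift + cenShuf c))‖ / ‖cenMap c (latPt (1 : E3 →L[ℝ] E3) hexFrame b + (hcpShift + cenShuf c))‖ * zetaN (cenMap c) (latPt (1 : E3 →L[ℝ] E3) hexFrame b + (hcpShift + cenShuf c)) k)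
      (fun b hb R hR => (ptA_mem c hR (hJA b hb)).1 k hk) (fun b hb R hR => (ptB_mem c hR (hJB b hb)).1 k hk)
    rw [← List.sum_toFinset _ (nearA_nodup c (trackW aP w)), ← List.sum_toFinset _ (nearB_nodup c (trackW aP w))] at hm
    exact hm
  -- (2) the linear term through the restricted gradient table
  have hlin : ∑ k ∈ range 9, ((cen ((gradTrack aP (passP c (nearA c (trackW aP w)) (nearB c (trackW aP w))).g).getD k fi0) : ℝ) / SC) * dispN (U - cenMap c) 0 k - ∑ k ∈ range 9, ((rad ((gradTrack aP (passP c (nearA c (trackW aP w)) (nearB c (trackW aP w))).g).getD k fi0) : ℝ) / SC) * |dispN (U - cenMap c) 0 k| ≤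
      (∑ b ∈ (nearA c (trackW aP w)).toFinset, deriv (effPot w₄₅ ω₄ (3 / 400)) ‖cenMap c (latPt (1 : E3 →L[ℝ] E3) hexFrame b)‖ / ‖cenMap c (latPt (1 : E3 →L[ℝ] E3) hexFrame b)‖ * ∑ k ∈ range 6, zetaN (cenMap c) (latPt (1 : E3 →L[ℝ] E3) hexFrame b) k * dispN (U - cenMap c) 0 k) + ∑ b ∈ (nearB c (trackW aP w)).toFinset, deriv (effPot w₄₅ ω₄ (3 / 400)) ‖cenMap c (latPt (1 : E3 →L[ℝ] E3) hexFrame b + (hcpShift + cenShuf c))‖ / ‖cenMap c (latPt (1 : E3 →L[ℝ] E3) hexFrame b + (hcpShift + cenShuf c))‖ * ∑ k ∈ range 9, zetaN (cenMap c) (latPt (1 : E3 →L[ℝ] E3) hexFrame b + (hcpShift + cenShuf c)) k * dispN (U - cenMap c) (ξ - cenShuf c) k := by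
    have eA : ∀ b : Fin 3 → ℤ, deriv (effPot w₄₅ ω₄ (3 / 400)) ‖cenMap c (latPt (1 : E3 →L[ℝ] E3) hexFrame b)‖ / ‖cenMap c (latPt (1 : E3 →L[ℝ] E3) hexFrame b)‖ * ∑ k ∈ range 6, zetaN (cenMap c) (latPt (1 : E3 →L[ℝ] E3) hexFrame b) k * dispN (U - cenMap c) 0 k = ∑ k ∈ range 9, (if k < 6 then deriv (effPot w₄₅ ω₄ (3 / 400)) ‖cenMap c (latPt (1 : E3 →L[ℝ] E3) hexFrame b)‖ / ‖cenMap c (latPt (1 : E3 →L[ℝ] E3) hexFrame b)‖ * zetaN (cenMap c) (latPt (1 : E3 →L[ℝ] E3) hexFrame b) k else 0) * dispN (U - cenMap c) (ξ - cenShuf c) k := fun b => by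
      rw [Finset.mul_sum, ← sum6_disp0 (U - cenMap c) (ξ - cenShuf c)]
      exact Finset.sum_congr rfl fun k _ => by ring
    have eB : ∀ b : Fin 3 → ℤ, deriv (effPot w₄₅ ω₄ (3 / 400)) ‖cenMap c (latPt (1 : E3 →L[ℝ] E3) hexFrame b + (hcpShift + cenShuf c))‖ / ‖cenMap c (latPt (1 : E3 →L[ℝ] E3) hexFrame b + (hcpShift + cenShuf c))‖ * ∑ k ∈ range 9, zetaN (cenMap c) (latPt (1 : E3 →L[ℝ] E3) hexFrame b + (hcpShift + cenShuf c)) k * dispN (U - cenMap c) (ξ - cenShuf c) k = ∑ k ∈ range 9, (deriv (effPot w₄₅ ω₄ (3 / 400)) ‖cenMap c (latPt (1 : E3 →L[ℝ] E3) hexFrame b + (hcpShift + cenShuf c))‖ / ‖cenMap c (latPt (1 : E3 →L[ℝ] E3) hexFrame b + (hcpShift + cenShuf c))‖ * zetaN (cenMap c) (latPt (1 : E3 →L[ℝ] E3) hexFrame b + (hcpShift + cenShuf c)) k) * dispN (U - cenMap c) (ξ - cenShuf c) k := fun b => by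
      rw [Finset.mul_sum]
      exact Finset.sum_congr rfl fun k _ => by ring
    simp only [eA, eB]
    rw [Finset.sum_comm (s := (nearA c (trackW aP w)).toFinset) (t := range 9), Finset.sum_comm (s := (nearB c (trackW aP w)).toFinset) (t := range 9),
      ← Finset.sum_add_distrib]
    have e3 : ∀ k ∈ range 9, (∑ b ∈ (nearA c (trackW aP w)).toFinset, (if k < 6 then deriv (effPot w₄₅ ω₄ (3 / 400)) ‖cenMap c (latPt (1 : E3 →L[ℝ] E3) hexFrame b)‖ / ‖cenMap c (latPt (1 : E3 →L[ℝ] E3) hexFrame b)‖ * zetaN (cenMap c) (latPt (1 : E3 →L[ℝ] E3) hexFrame b) k else 0) * dispN (U - cenMap c) (ξ - cenShuf c) k) +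
        ∑ b ∈ (nearB c (trackW aP w)).toFinset, (deriv (effPot w₄₅ ω₄ (3 / 400)) ‖cenMap c (latPt (1 : E3 →L[ℝ] E3) hexFrame b + (hcpShift + cenShuf c))‖ / ‖cenMap c (latPt (1 : E3 →L[ℝ] E3) hexFrame b + (hcpShift + cenShuf c))‖ * zetaN (cenMap c) (latPt (1 : E3 →L[ℝ] E3) hexFrame b + (hcpShift + cenShuf c)) k) * dispN (U - cenMap c) (ξ - cenShuf c) k = ((∑ b ∈ (nearA c (trackW aP w)).toFinset, (if k < 6 then deriv (effPot w₄₅ ω₄ (3 / 400)) ‖cenMap c (latPt (1 : E3 →L[ℝ] E3) hexFrame b)‖ / ‖cenMap c (latPt (1 : E3 →L[ℝ] E3) hexFrame b)‖ * zetaN (cenMap c) (latPt (1 : E3 →L[ℝ] E3) hexFrame b) k else 0)) + ∑ b ∈ (nearB c (trackW aP w)).toFinset, deriv (effPot w₄₅ ω₄ (3 / 400)) ‖cenMap c (latPt (1 : E3 →L[ℝ] E3) hexFrame b + (hcpShift + cenShuf c))‖ / ‖cenMap c (latPt (1 : E3 →L[ℝ] E3) hexFrame b + (hcpShift + cenShuf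 c))‖ * zetaN (cenMap c) (latPt (1 : E3 →L[ℝ] E3) hexFrame b + (hcpShift + cenShuf c)) k) * dispN (U - cenMap c) (ξ - cenShuf c) k := fun k _ => by
      rw [add_mul, Finset.sum_mul, Finset.sum_mul]
    rw [Finset.sum_congr rfl e3]
    -- through the graph: `Σ_k G_k δ_k = Σ_e G̃_e δ_e = Σ_k [k<6] G̃_k x_k`
    rw [lin_graph (fun k => ((∑ b ∈ (nearA c (trackW aP w)).toFinset, (if k < 6 then deriv (effPot w₄₅ ω₄ (3 / 400)) ‖cenMap c (latPt (1 : E3 →L[ℝ] E3) hexFrame b)‖ / ‖cenMap c (latPt (1 : E3 →L[ℝ] E3) hexFrame b)‖ * zetaN (cenMap c) (latPt (1 : E3 →L[ℝ] E3) hexFrame b) k else 0)) + ∑ b ∈ (nearB c (trackW aP w)).toFinset, deriv (effPot w₄₅ ω₄ (3 / 400)) ‖cenMap c (latPt (1 : E3 →L[ℝ] E3) hexFrame b + (hcpShift + cenShuf c))‖ / ‖cenMap c (latPt (1 : E3 →L[ℝ] E3) hexFrame b + (hcpShift + cenShuf c))‖ * zetaN (cenMap c) (latPt (1 : E3 →L[ℝ]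 E3) hexFrame b + (hcpShift + cenShuf c)) k)) (dispN (U - cenMap c) (ξ - cenShuf c)) A hgraph]
    have e4 : ∑ e ∈ range 6, ((fun k => ((∑ b ∈ (nearA c (trackW aP w)).toFinset, (if k < 6 then deriv (effPot w₄₅ ω₄ (3 / 400)) ‖cenMap c (latPt (1 : E3 →L[ℝ] E3) hexFrame b)‖ / ‖cenMap c (latPt (1 : E3 →L[ℝ] E3) hexFrame b)‖ * zetaN (cenMap c) (latPt (1 : E3 →L[ℝ] E3) hexFrame b) k else 0)) + ∑ b ∈ (nearB c (trackW aP w)).toFinset, deriv (effPot w₄₅ ω₄ (3 / 400)) ‖cenMap c (latPt (1 : E3 →L[ℝ] E3) hexFrame b + (hcpShift + cenShuf c))‖ / ‖cenMap c (latPt (1 : E3 →L[ℝ] E3) hexFrame b + (hcpShift + cenShuf c))‖ * zetaN (cenMap c) (latPt (1 : E3 →L[ℝ] E3) hexFrame b + (hcpShift + cenShuf c)) k)) e + (A 0 e * (fun k => ((∑ b ∈ (nearA c (trackW aP w)).toFinset, (if k < 6 then deriv (effPot w₄₅ ω₄ (3 / 400)) ‖cenMap c (latPt (1 : E3 →L[ℝ]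 E3) hexFrame b)‖ / ‖cenMap c (latPt (1 : E3 →L[ℝ] E3) hexFrame b)‖ * zetaN (cenMap c) (latPt (1 : E3 →L[ℝ] E3) hexFrame b) k else 0)) + ∑ b ∈ (nearB c (trackW aP w)).toFinset, deriv (effPot w₄₅ ω₄ (3 / 400)) ‖cenMap c (latPt (1 : E3 →L[ℝ] E3) hexFrame b + (hcpShift + cenShuf c))‖ / ‖cenMap c (latPt (1 : E3 →L[ℝ] E3) hexFrame b + (hcpShift + cenShuf c))‖ * zetaN (cenMap c) (latPt (1 : E3 →L[ℝ] E3) hexFrame b + (hcpShift + cenShuf c)) k)) 6 + A 1 e * (fun k => ((∑ b ∈ (nearA c (trackW aP w)).toFinset, (if k < 6 then deriv (effPot w₄₅ ω₄ (3 / 400)) ‖cenMap c (latPt (1 : E3 →L[ℝ] E3) hexFrame b)‖ / ‖cenMap c (latPt (1 : E3 →L[ℝ] E3) hexFrame b)‖ * zetaN (cenMap c) (latPt (1 : E3 →L[ℝ] E3) hexFrame b) k else 0)) + ∑ b ∈ (nearB c (trackW aP w)).toFinset, deriv (effPot w₄₅ ω₄ (3 / 400)) ‖cenMap c (latPt (1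 : E3 →L[ℝ] E3) hexFrame b + (hcpShift + cenShuf c))‖ / ‖cenMap c (latPt (1 : E3 →L[ℝ] E3) hexFrame b + (hcpShift + cenShuf c))‖ * zetaN (cenMap c) (latPt (1 : E3 →L[ℝ] E3) hexFrame b + (hcpShift + cenShuf c)) k)) 7 +
        A 2 e * (fun k => ((∑ b ∈ (nearA c (trackW aP w)).toFinset, (if k < 6 then deriv (effPot w₄₅ ω₄ (3 / 400)) ‖cenMap c (latPt (1 : E3 →L[ℝ] E3) hexFrame b)‖ / ‖cenMap c (latPt (1 : E3 →L[ℝ] E3) hexFrame b)‖ * zetaN (cenMap c) (latPt (1 : E3 →L[ℝ] E3) hexFrame b) k else 0)) + ∑ b ∈ (nearB c (trackW aP w)).toFinset, deriv (effPot w₄₅ ω₄ (3 / 400)) ‖cenMap c (latPt (1 : E3 →L[ℝ] E3) hexFrame b + (hcpShift + cenShuf c))‖ / ‖cenMap c (latPt (1 : E3 →L[ℝ] E3) hexFrame b + (hcpShift + cenShuf c))‖ * zetaN (cenMap c) (latPt (1 : E3 →L[ℝ] E3) hexFrame b + (hcpShift + cenShuf c)) k)) 8)) * dispN (U - cenMap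 c) (ξ - cenShuf c) e =
        ∑ k ∈ range 9, (if k < 6 then ((fun k => ((∑ b ∈ (nearA c (trackW aP w)).toFinset, (if k < 6 then deriv (effPot w₄₅ ω₄ (3 / 400)) ‖cenMap c (latPt (1 : E3 →L[ℝ] E3) hexFrame b)‖ / ‖cenMap c (latPt (1 : E3 →L[ℝ] E3) hexFrame b)‖ * zetaN (cenMap c) (latPt (1 : E3 →L[ℝ] E3) hexFrame b) k else 0)) + ∑ b ∈ (nearB c (trackW aP w)).toFinset, deriv (effPot w₄₅ ω₄ (3 / 400)) ‖cenMap c (latPt (1 : E3 →L[ℝ] E3) hexFrame b + (hcpShift + cenShuf c))‖ / ‖cenMap c (latPt (1 : E3 →L[ℝ] E3) hexFrame b + (hcpShift + cenShuf c))‖ * zetaN (cenMap c) (latPt (1 : E3 →L[ℝ] E3) hexFrame b + (hcpShift + cenShuf c)) k)) k + (A 0 k * (fun k => ((∑ b ∈ (nearA c (trackW aP w)).toFinset, (if k < 6 then deriv (effPot w₄₅ ω₄ (3 / 400)) ‖cenMap c (latPt (1 : E3 →L[ℝ] E3) hexFrame b)‖ / ‖cenMap c (latPt (1 : E3 →L[ℝ]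 E3) hexFrame b)‖ * zetaN (cenMap c) (latPt (1 : E3 →L[ℝ] E3) hexFrame b) k else 0)) + ∑ b ∈ (nearB c (trackW aP w)).toFinset, deriv (effPot w₄₅ ω₄ (3 / 400)) ‖cenMap c (latPt (1 : E3 →L[ℝ] E3) hexFrame b + (hcpShift + cenShuf c))‖ / ‖cenMap c (latPt (1 : E3 →L[ℝ] E3) hexFrame b + (hcpShift + cenShuf c))‖ * zetaN (cenMap c) (latPt (1 : E3 →L[ℝ] E3) hexFrame b + (hcpShift + cenShuf c)) k)) 6 + A 1 k * (fun k => ((∑ b ∈ (nearA c (trackW aP w)).toFinset, (if k < 6 then deriv (effPot w₄₅ ω₄ (3 / 400)) ‖cenMap c (latPt (1 : E3 →L[ℝ] E3) hexFrame b)‖ / ‖cenMap c (latPt (1 : E3 →L[ℝ] E3) hexFrame b)‖ * zetaN (cenMap c) (latPt (1 : E3 →L[ℝ] E3) hexFrame b) k else 0)) + ∑ b ∈ (nearB c (trackW aP w)).toFinset, deriv (effPot w₄₅ ω₄ (3 / 400)) ‖cenMap c (latPt (1 : E3 →L[ℝ] E3) hexFrame b + (hcpShift + cenShuf c))‖ /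 ‖cenMap c (latPt (1 : E3 →L[ℝ] E3) hexFrame b + (hcpShift + cenShuf c))‖ * zetaN (cenMap c) (latPt (1 : E3 →L[ℝ] E3) hexFrame b + (hcpShift + cenShuf c)) k)) 7 +
          A 2 k * (fun k => ((∑ b ∈ (nearA c (trackW aP w)).toFinset, (if k < 6 then deriv (effPot w₄₅ ω₄ (3 / 400)) ‖cenMap c (latPt (1 : E3 →L[ℝ] E3) hexFrame b)‖ / ‖cenMap c (latPt (1 : E3 →L[ℝ] E3) hexFrame b)‖ * zetaN (cenMap c) (latPt (1 : E3 →L[ℝ] E3) hexFrame b) k else 0)) + ∑ b ∈ (nearB c (trackW aP w)).toFinset, deriv (effPot w₄₅ ω₄ (3 / 400)) ‖cenMap c (latPt (1 : E3 →L[ℝ] E3) hexFrame b + (hcpShift + cenShuf c))‖ / ‖cenMap c (latPt (1 : E3 →L[ℝ] E3) hexFrame b + (hcpShift + cenShuf c))‖ * zetaN (cenMap c) (latPt (1 : E3 →L[ℝ] E3) hexFrame b + (hcpShift + cenShuf c)) k)) 8)) else 0) * dispN (U - cenMap c) 0 k := by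
      rw [show (∑ e ∈ range 6, ((fun k => ((∑ b ∈ (nearA c (trackW aP w)).toFinset, (if k < 6 then deriv (effPot w₄₅ ω₄ (3 / 400)) ‖cenMap c (latPt (1 : E3 →L[ℝ] E3) hexFrame b)‖ / ‖cenMap c (latPt (1 : E3 →L[ℝ] E3) hexFrame b)‖ * zetaN (cenMap c) (latPt (1 : E3 →L[ℝ] E3) hexFrame b) k else 0)) + ∑ b ∈ (nearB c (trackW aP w)).toFinset, deriv (effPot w₄₅ ω₄ (3 / 400)) ‖cenMap c (latPt (1 : E3 →L[ℝ] E3) hexFrame b + (hcpShift + cenShuf c))‖ / ‖cenMap c (latPt (1 : E3 →L[ℝ] E3) hexFrame b + (hcpShift + cenShuf c))‖ * zetaN (cenMap c) (latPt (1 : E3 →L[ℝ] E3) hexFrame b + (hcpShift + cenShuf c)) k)) e + (A 0 e * (fun k => ((∑ b ∈ (nearA c (trackW aP w)).toFinset, (if k < 6 then deriv (effPot w₄₅ ω₄ (3 / 400)) ‖cenMap c (latPt (1 : E3 →L[ℝ] E3) hexFrame b)‖ / ‖cenMap c (latPt (1 : E3 →L[ℝ] E3) hexFrame b)‖ * zetaN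 (cenMap c) (latPt (1 : E3 →L[ℝ] E3) hexFrame b) k else 0)) + ∑ b ∈ (nearB c (trackW aP w)).toFinset, deriv (effPot w₄₅ ω₄ (3 / 400)) ‖cenMap c (latPt (1 : E3 →L[ℝ] E3) hexFrame b + (hcpShift + cenShuf c))‖ / ‖cenMap c (latPt (1 : E3 →L[ℝ] E3) hexFrame b + (hcpShift + cenShuf c))‖ * zetaN (cenMap c) (latPt (1 : E3 →L[ℝ] E3) hexFrame b + (hcpShift + cenShuf c)) k)) 6 + A 1 e * (fun k => ((∑ b ∈ (nearA c (trackW aP w)).toFinset, (if k < 6 then deriv (effPot w₄₅ ω₄ (3 / 400)) ‖cenMap c (latPt (1 : E3 →L[ℝ] E3) hexFrame b)‖ / ‖cenMap c (latPt (1 : E3 →L[ℝ] E3) hexFrame b)‖ * zetaN (cenMap c) (latPt (1 : E3 →L[ℝ] E3) hexFrame b) k else 0)) + ∑ b ∈ (nearB c (trackW aP w)).toFinset, deriv (effPot w₄₅ ω₄ (3 / 400)) ‖cenMap c (latPt (1 : E3 →L[ℝ] E3) hexFrame b + (hcpShift + cenShuf c))‖ / ‖cenMap c (latPt (1 : E3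 →L[ℝ] E3) hexFrame b + (hcpShift + cenShuf c))‖ * zetaN (cenMap c) (latPt (1 : E3 →L[ℝ] E3) hexFrame b + (hcpShift + cenShuf c)) k)) 7 +
          A 2 e * (fun k => ((∑ b ∈ (nearA c (trackW aP w)).toFinset, (if k < 6 then deriv (effPot w₄₅ ω₄ (3 / 400)) ‖cenMap c (latPt (1 : E3 →L[ℝ] E3) hexFrame b)‖ / ‖cenMap c (latPt (1 : E3 →L[ℝ] E3) hexFrame b)‖ * zetaN (cenMap c) (latPt (1 : E3 →L[ℝ] E3) hexFrame b) k else 0)) + ∑ b ∈ (nearB c (trackW aP w)).toFinset, deriv (effPot w₄₅ ω₄ (3 / 400)) ‖cenMap c (latPt (1 : E3 →L[ℝ] E3) hexFrame b + (hcpShift + cenShuf c))‖ / ‖cenMap c (latPt (1 : E3 →L[ℝ] E3) hexFrame b + (hcpShift + cenShuf c))‖ * zetaN (cenMap c) (latPt (1 : E3 →L[ℝ] E3) hexFrame b + (hcpShift + cenShuf c)) k)) 8)) * dispN (U - cenMap c) (ξ - cenShuf c) e) = ∑ e ∈ range 6, ((fun k => ((∑ b ∈ (nearA c (trackW aP w)).toFinset,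 (if k < 6 then deriv (effPot w₄₅ ω₄ (3 / 400)) ‖cenMap c (latPt (1 : E3 →L[ℝ] E3) hexFrame b)‖ / ‖cenMap c (latPt (1 : E3 →L[ℝ] E3) hexFrame b)‖ * zetaN (cenMap c) (latPt (1 : E3 →L[ℝ] E3) hexFrame b) k else 0)) + ∑ b ∈ (nearB c (trackW aP w)).toFinset, deriv (effPot w₄₅ ω₄ (3 / 400)) ‖cenMap c (latPt (1 : E3 →L[ℝ] E3) hexFrame b + (hcpShift + cenShuf c))‖ / ‖cenMap c (latPt (1 : E3 →L[ℝ] E3) hexFrame b + (hcpShift + cenShuf c))‖ * zetaN (cenMap c) (latPt (1 : E3 →L[ℝ] E3) hexFrame b + (hcpShift + cenShuf c)) k)) e + (A 0 e * (fun k => ((∑ b ∈ (nearA c (trackW aP w)).toFinset, (if k < 6 then deriv (effPot w₄₅ ω₄ (3 / 400)) ‖cenMap c (latPt (1 : E3 →L[ℝ] E3) hexFrame b)‖ / ‖cenMap c (latPt (1 : E3 →L[ℝ] E3) hexFrame b)‖ * zetaN (cenMap c) (latPt (1 : E3 →L[ℝ] E3) hexFrame b) k else 0)) + ∑ b ∈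 (nearB c (trackW aP w)).toFinset, deriv (effPot w₄₅ ω₄ (3 / 400)) ‖cenMap c (latPt (1 : E3 →L[ℝ] E3) hexFrame b + (hcpShift + cenShuf c))‖ / ‖cenMap c (latPt (1 : E3 →L[ℝ] E3) hexFrame b + (hcpShift + cenShuf c))‖ * zetaN (cenMap c) (latPt (1 : E3 →L[ℝ] E3) hexFrame b + (hcpShift + cenShuf c)) k)) 6 +
          A 1 e * (fun k => ((∑ b ∈ (nearA c (trackW aP w)).toFinset, (if k < 6 then deriv (effPot w₄₅ ω₄ (3 / 400)) ‖cenMap c (latPt (1 : E3 →L[ℝ] E3) hexFrame b)‖ / ‖cenMap c (latPt (1 : E3 →L[ℝ] E3) hexFrame b)‖ * zetaN (cenMap c) (latPt (1 : E3 →L[ℝ] E3) hexFrame b) k else 0)) + ∑ b ∈ (nearB c (trackW aP w)).toFinset, deriv (effPot w₄₅ ω₄ (3 / 400)) ‖cenMap c (latPt (1 : E3 →L[ℝ] E3) hexFrame b + (hcpShift + cenShuf c))‖ / ‖cenMap c (latPt (1 : E3 →L[ℝ] E3) hexFrame b + (hcpShift + cenShuf c))‖ * zetaN (cenMap c) (latPt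 (1 : E3 →L[ℝ] E3) hexFrame b + (hcpShift + cenShuf c)) k)) 7 + A 2 e * (fun k => ((∑ b ∈ (nearA c (trackW aP w)).toFinset, (if k < 6 then deriv (effPot w₄₅ ω₄ (3 / 400)) ‖cenMap c (latPt (1 : E3 →L[ℝ] E3) hexFrame b)‖ / ‖cenMap c (latPt (1 : E3 →L[ℝ] E3) hexFrame b)‖ * zetaN (cenMap c) (latPt (1 : E3 →L[ℝ] E3) hexFrame b) k else 0)) + ∑ b ∈ (nearB c (trackW aP w)).toFinset, deriv (effPot w₄₅ ω₄ (3 / 400)) ‖cenMap c (latPt (1 : E3 →L[ℝ] E3) hexFrame b + (hcpShift + cenShuf c))‖ / ‖cenMap c (latPt (1 : E3 →L[ℝ] E3) hexFrame b + (hcpShift + cenShuf c))‖ * zetaN (cenMap c) (latPt (1 : E3 →L[ℝ] E3) hexFrame b + (hcpShift + cenShuf c)) k)) 8)) * dispN (U - cenMap c) 0 e from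
        Finset.sum_congr rfl fun e he => by rw [dispN_xi_zero _ (ξ - cenShuf c) (by have := Finset.mem_range.1 he; omega), if_pos (Finset.mem_range.1 he)]]
      rw [sum6_disp0 (U - cenMap c) 0]
    rw [e4]
    refine sum_lin_bound _ _ (fun k => (gradTrack aP (passP c (nearA c (trackW aP w)) (nearB c (trackW aP w))).g).getD k fi0) fun k hk => ?_
    by_cases hk6 : k < 6
    · rw [if_pos hk6]
      have hg := mem_gradTrack aP (passP c (nearA c (trackW aP w)) (nearB c (trackW aP w))).g (fun k => ((∑ b ∈ (nearA c (trackW aP w)).toFinset, (if k < 6 then deriv (effPot w₄₅ ω₄ (3 / 400)) ‖cenMap c (latPt (1 : E3 →L[ℝ] E3) hexFrame b)‖ / ‖cenMap c (latPt (1 : E3 →L[ℝ] E3) hexFrame b)‖ * zetaN (cenMap c) (latPt (1 : E3 →L[ℝ] E3) hexFrame b) k else 0)) + ∑ b ∈ (nearB c (trackW aP w)).toFinset, deriv (effPot w₄₅ ω₄ (3 / 400)) ‖cenMap c (latPt (1 : E3 →L[ℝ] E3) hexFrame b + (hcpShift + cenShuf c))‖ / ‖cenMap c (latPt (1 : E3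 →L[ℝ] E3) hexFrame b + (hcpShift + cenShuf c))‖ * zetaN (cenMap c) (latPt (1 : E3 →L[ℝ] E3) hexFrame b + (hcpShift + cenShuf c)) k)) hmem hk6
      simp only [hA, dif_pos hk6]
      exact hg
    · rw [if_neg hk6, gradTrack_ge6 aP _ (not_lt.1 hk6) hk]
      exact mem_fi0
  have hmemH : ∀ k l, k < 9 → l < 9 → FI.mem ((fun k l => ((∑ b ∈ (nearA c (trackW aP w)).toFinset, (if k < 6 ∧ l < 6 then ((deriv (deriv (effPot w₄₅ ω₄ (3 / 400))) ‖cenMap c (latPt (1 : E3 →L[ℝ] E3) hexFrame b)‖ - deriv (effPot w₄₅ ω₄ (3 / 400)) ‖cenMap c (latPt (1 : E3 →L[ℝ] E3) hexFrame b)‖ / ‖cenMap c (latPt (1 : E3 →L[ℝ] E3) hexFrame b)‖) / ‖cenMap c (latPt (1 : E3 →L[ℝ] E3) hexFrame b)‖ ^ 2 * (zetaN (cenMap c) (latPt (1 : E3 →L[ℝ] E3) hexFrame b) k * zetaN (cenMap c) (latPt (1 : E3 →L[ℝ] E3) hexFrame b) l) + deriv (effPot w₄₅ ω₄ (3 / 400))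 ‖cenMap c (latPt (1 : E3 →L[ℝ] E3) hexFrame b)‖ / ‖cenMap c (latPt (1 : E3 →L[ℝ] E3) hexFrame b)‖ * nuR (cenMap c) (latPt (1 : E3 →L[ℝ] E3) hexFrame b) k l) else 0)) + ∑ b ∈ (nearB c (trackW aP w)).toFinset, ((deriv (deriv (effPot w₄₅ ω₄ (3 / 400))) ‖cenMap c (latPt (1 : E3 →L[ℝ] E3) hexFrame b + (hcpShift + cenShuf c))‖ - deriv (effPot w₄₅ ω₄ (3 / 400)) ‖cenMap c (latPt (1 : E3 →L[ℝ] E3) hexFrame b + (hcpShift + cenShuf c))‖ / ‖cenMap c (latPt (1 : E3 →L[ℝ] E3) hexFrame b + (hcpShift + cenShuf c))‖) / ‖cenMap c (latPt (1 : E3 →L[ℝ] E3) hexFrame b + (hcpShift + cenShuf c))‖ ^ 2 * (zetaN (cenMap c) (latPt (1 : E3 →L[ℝ] E3) hexFrame b + (hcpShift + cenShuf c)) k * zetaN (cenMap c) (latPt (1 : E3 →L[ℝ] E3) hexFrame b + (hcpShift + cenShuf c)) l) + deriv (effPot w₄₅ ω₄ (3 / 400)) ‖cenMap c (latPt (1 :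 E3 →L[ℝ] E3) hexFrame b + (hcpShift + cenShuf c))‖ / ‖cenMap c (latPt (1 : E3 →L[ℝ] E3) hexFrame b + (hcpShift + cenShuf c))‖ * nuR (cenMap c) (latPt (1 : E3 →L[ℝ] E3) hexFrame b + (hcpShift + cenShuf c)) k l))) k l) ((passP c (nearA c (trackW aP w)) (nearB c (trackW aP w))).H.getD (9 * k + l) fi0) := fun k l hk hl => by
    have hm := hPH (9 * k + l) (by omega)
      (fun b => if k < 6 ∧ l < 6 then ((deriv (deriv (effPot w₄₅ ω₄ (3 / 400))) ‖cenMap c (latPt (1 : E3 →L[ℝ] E3) hexFrame b)‖ - deriv (effPot w₄₅ ω₄ (3 / 400)) ‖cenMap c (latPt (1 : E3 →L[ℝ] E3) hexFrame b)‖ / ‖cenMap c (latPt (1 : E3 →L[ℝ] E3) hexFrame b)‖) / ‖cenMap c (latPt (1 : E3 →L[ℝ] E3) hexFrame b)‖ ^ 2 * (zetaN (cenMap c) (latPt (1 : E3 →L[ℝ] E3) hexFrame b) k * zetaN (cenMap c) (latPt (1 : E3 →L[ℝ] E3) hexFrame b) l) + deriv (effPot w₄₅ ω₄ (3 / 400))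 ‖cenMap c (latPt (1 : E3 →L[ℝ] E3) hexFrame b)‖ / ‖cenMap c (latPt (1 : E3 →L[ℝ] E3) hexFrame b)‖ * nuR (cenMap c) (latPt (1 : E3 →L[ℝ] E3) hexFrame b) k l) else 0) (fun b => ((deriv (deriv (effPot w₄₅ ω₄ (3 / 400))) ‖cenMap c (latPt (1 : E3 →L[ℝ] E3) hexFrame b + (hcpShift + cenShuf c))‖ - deriv (effPot w₄₅ ω₄ (3 / 400)) ‖cenMap c (latPt (1 : E3 →L[ℝ] E3) hexFrame b + (hcpShift + cenShuf c))‖ / ‖cenMap c (latPt (1 : E3 →L[ℝ] E3) hexFrame b + (hcpShift + cenShuf c))‖) / ‖cenMap c (latPt (1 : E3 →L[ℝ] E3) hexFrame b + (hcpShift + cenShuf c))‖ ^ 2 * (zetaN (cenMap c) (latPt (1 : E3 →L[ℝ] E3) hexFrame b + (hcpShift + cenShuf c)) k * zetaN (cenMap c) (latPt (1 : E3 →L[ℝ] E3) hexFrame b + (hcpShift + cenShuf c)) l) + deriv (effPot w₄₅ ω₄ (3 / 400)) ‖cenMap c (latPt (1 : E3 →L[ℝ] E3) hexFrame b + (hcpShift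 + cenShuf c))‖ / ‖cenMap c (latPt (1 : E3 →L[ℝ] E3) hexFrame b + (hcpShift + cenShuf c))‖ * nuR (cenMap c) (latPt (1 : E3 →L[ℝ] E3) hexFrame b + (hcpShift + cenShuf c)) k l))
      (fun b hb R hR => (ptA_mem c hR (hJA b hb)).2 k l hk hl) (fun b hb R hR => (ptB_mem c hR (hJB b hb)).2 k l hk hl)
    rw [← List.sum_toFinset _ (nearA_nodup c (trackW aP w)), ← List.sum_toFinset _ (nearB_nodup c (trackW aP w))] at hm
    exact hm
  -- (3) the quadratic term through the restricted Hessian table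
  have hquad : 1 / 2 * (∑ k ∈ range 9, ∑ l ∈ range 9, ((cen ((hessTrack aP (passP c (nearA c (trackW aP w)) (nearB c (trackW aP w))).H).getD (9 * k + l) fi0) : ℝ) / SC) * (dispN (U - cenMap c) 0 k * dispN (U - cenMap c) 0 l) -
      ∑ k ∈ range 9, ∑ l ∈ range 9, ((rad ((hessTrack aP (passP c (nearA c (trackW aP w)) (nearB c (trackW aP w))).H).getD (9 * k + l) fi0) : ℝ) / SC) * (|dispN (U - cenMap c) 0 k| * |dispN (U - cenMap c) 0 l|)) ≤
      (∑ b ∈ (nearA c (trackW aP w)).toFinset, 1 / 2 * ∑ k ∈ range 6, ∑ l ∈ range 6, ((deriv (deriv (effPot w₄₅ ω₄ (3 / 400))) ‖cenMap c (latPt (1 : E3 →L[ℝ] E3) hexFrame b)‖ - deriv (effPot w₄₅ ω₄ (3 / 400)) ‖cenMap c (latPt (1 : E3 →L[ℝ] E3) hexFrame b)‖ / ‖cenMap c (latPt (1 : E3 →L[ℝ] E3) hexFrame b)‖) / ‖cenMap c (latPt (1 : E3 →L[ℝ] E3) hexFrame b)‖ ^ 2 * (zetaN (cenMap c) (latPt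 (1 : E3 →L[ℝ] E3) hexFrame b) k * zetaN (cenMap c) (latPt (1 : E3 →L[ℝ] E3) hexFrame b) l) + deriv (effPot w₄₅ ω₄ (3 / 400)) ‖cenMap c (latPt (1 : E3 →L[ℝ] E3) hexFrame b)‖ / ‖cenMap c (latPt (1 : E3 →L[ℝ] E3) hexFrame b)‖ * nuR (cenMap c) (latPt (1 : E3 →L[ℝ] E3) hexFrame b) k l) * (dispN (U - cenMap c) 0 k * dispN (U - cenMap c) 0 l)) + ∑ b ∈ (nearB c (trackW aP w)).toFinset, 1 / 2 * ∑ k ∈ range 9, ∑ l ∈ range 9, ((deriv (deriv (effPot w₄₅ ω₄ (3 / 400))) ‖cenMap c (latPt (1 : E3 →L[ℝ] E3) hexFrame b + (hcpShift + cenShuf c))‖ - deriv (effPot w₄₅ ω₄ (3 / 400)) ‖cenMap c (latPt (1 : E3 →L[ℝ] E3) hexFrame b + (hcpShift + cenShuf c))‖ / ‖cenMap c (latPt (1 : E3 →L[ℝ] E3) hexFrame b + (hcpShift + cenShuf c))‖) / ‖cenMap c (latPt (1 : E3 →L[ℝ] E3) hexFrame b + (hcpShift + cenShuf c))‖ ^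 2 * (zetaN (cenMap c) (latPt (1 : E3 →L[ℝ] E3) hexFrame b + (hcpShift + cenShuf c)) k * zetaN (cenMap c) (latPt (1 : E3 →L[ℝ] E3) hexFrame b + (hcpShift + cenShuf c)) l) + deriv (effPot w₄₅ ω₄ (3 / 400)) ‖cenMap c (latPt (1 : E3 →L[ℝ] E3) hexFrame b + (hcpShift + cenShuf c))‖ / ‖cenMap c (latPt (1 : E3 →L[ℝ] E3) hexFrame b + (hcpShift + cenShuf c))‖ * nuR (cenMap c) (latPt (1 : E3 →L[ℝ] E3) hexFrame b + (hcpShift + cenShuf c)) k l) * (dispN (U - cenMap c) (ξ - cenShuf c) k * dispN (U - cenMap c) (ξ - cenShuf c) l) := by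
    have eA : ∀ b : Fin 3 → ℤ, ∑ k ∈ range 6, ∑ l ∈ range 6, ((deriv (deriv (effPot w₄₅ ω₄ (3 / 400))) ‖cenMap c (latPt (1 : E3 →L[ℝ] E3) hexFrame b)‖ - deriv (effPot w₄₅ ω₄ (3 / 400)) ‖cenMap c (latPt (1 : E3 →L[ℝ] E3) hexFrame b)‖ / ‖cenMap c (latPt (1 : E3 →L[ℝ] E3) hexFrame b)‖) / ‖cenMap c (latPt (1 : E3 →L[ℝ] E3) hexFrame b)‖ ^ 2 * (zetaN (cenMap c) (latPt (1 : E3 →L[ℝ] E3) hexFrame b) k * zetaN (cenMap c) (latPt (1 : E3 →L[ℝ] E3) hexFrame b) l) + deriv (effPot w₄₅ ω₄ (3 / 400)) ‖cenMap c (latPt (1 : E3 →L[ℝ] E3) hexFrame b)‖ / ‖cenMap c (latPt (1 : E3 →L[ℝ] E3) hexFrame b)‖ * nuR (cenMap c) (latPt (1 : E3 →L[ℝ] E3) hexFrame b) k l) * (dispN (U - cenMap c) 0 k * dispN (U - cenMap c) 0 l) =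
        ∑ k ∈ range 9, ∑ l ∈ range 9, (if k < 6 ∧ l < 6 then ((deriv (deriv (effPot w₄₅ ω₄ (3 / 400))) ‖cenMap c (latPt (1 : E3 →L[ℝ] E3) hexFrame b)‖ - deriv (effPot w₄₅ ω₄ (3 / 400)) ‖cenMap c (latPt (1 : E3 →L[ℝ] E3) hexFrame b)‖ / ‖cenMap c (latPt (1 : E3 →L[ℝ] E3) hexFrame b)‖) / ‖cenMap c (latPt (1 : E3 →L[ℝ] E3) hexFrame b)‖ ^ 2 * (zetaN (cenMap c) (latPt (1 : E3 →L[ℝ] E3) hexFrame b) k * zetaN (cenMap c) (latPt (1 : E3 →L[ℝ] E3) hexFrame b) l) + deriv (effPot w₄₅ ω₄ (3 / 400)) ‖cenMap c (latPt (1 : E3 →L[ℝ] E3) hexFrame b)‖ / ‖cenMap c (latPt (1 : E3 →L[ℝ] E3) hexFrame b)‖ * nuR (cenMap c) (latPt (1 : E3 →L[ℝ] E3) hexFrame b) k l) else 0) * (dispN (U - cenMap c) (ξ - cenShuf c) k * dispN (U - cenMap c) (ξ - cenShuf c) l) := fun b =>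
      sum66_disp0 (U - cenMap c) (ξ - cenShuf c) _
    simp only [eA]
    rw [← Finset.mul_sum, ← Finset.mul_sum, ← mul_add]
    refine mul_le_mul_of_nonneg_left ?_ (by norm_num)
    rw [Finset.sum_comm (s := (nearA c (trackW aP w)).toFinset) (t := range 9), Finset.sum_comm (s := (nearB c (trackW aP w)).toFinset) (t := range 9),
      ← Finset.sum_add_distrib]
    have e3 : ∀ k ∈ range 9, (∑ b ∈ (nearA c (trackW aP w)).toFinset, ∑ l ∈ range 9, (if k < 6 ∧ l < 6 then ((deriv (deriv (effPot w₄₅ ω₄ (3 / 400))) ‖cenMap c (latPt (1 : E3 →L[ℝ] E3) hexFrame b)‖ - deriv (effPot w₄₅ ω₄ (3 / 400)) ‖cenMap c (latPt (1 : E3 →L[ℝ] E3) hexFrame b)‖ / ‖cenMap c (latPt (1 : E3 →L[ℝ] E3) hexFrame b)‖) / ‖cenMap c (latPt (1 : E3 →L[ℝ] E3) hexFrame b)‖ ^ 2 * (zetaN (cenMap c) (latPt (1 : E3 →L[ℝ] E3) hexFrame b) k * zetaN (cenMap c) (latPt (1 : E3 →L[ℝ] E3) hexFrame b) l) + deriv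 (effPot w₄₅ ω₄ (3 / 400)) ‖cenMap c (latPt (1 : E3 →L[ℝ] E3) hexFrame b)‖ / ‖cenMap c (latPt (1 : E3 →L[ℝ] E3) hexFrame b)‖ * nuR (cenMap c) (latPt (1 : E3 →L[ℝ] E3) hexFrame b) k l) else 0) * (dispN (U - cenMap c) (ξ - cenShuf c) k * dispN (U - cenMap c) (ξ - cenShuf c) l)) +
        ∑ b ∈ (nearB c (trackW aP w)).toFinset, ∑ l ∈ range 9, ((deriv (deriv (effPot w₄₅ ω₄ (3 / 400))) ‖cenMap c (latPt (1 : E3 →L[ℝ] E3) hexFrame b + (hcpShift + cenShuf c))‖ - deriv (effPot w₄₅ ω₄ (3 / 400)) ‖cenMap c (latPt (1 : E3 →L[ℝ] E3) hexFrame b + (hcpShift + cenShuf c))‖ / ‖cenMap c (latPt (1 : E3 →L[ℝ] E3) hexFrame b + (hcpShift + cenShuf c))‖) / ‖cenMap c (latPt (1 : E3 →L[ℝ] E3) hexFrame b + (hcpShift + cenShuf c))‖ ^ 2 * (zetaN (cenMap c) (latPt (1 : E3 →L[ℝ] E3) hexFrame b + (hcpShift + cenShuf c)) k * zetaN (cenMap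 c) (latPt (1 : E3 →L[ℝ] E3) hexFrame b + (hcpShift + cenShuf c)) l) + deriv (effPot w₄₅ ω₄ (3 / 400)) ‖cenMap c (latPt (1 : E3 →L[ℝ] E3) hexFrame b + (hcpShift + cenShuf c))‖ / ‖cenMap c (latPt (1 : E3 →L[ℝ] E3) hexFrame b + (hcpShift + cenShuf c))‖ * nuR (cenMap c) (latPt (1 : E3 →L[ℝ] E3) hexFrame b + (hcpShift + cenShuf c)) k l) * (dispN (U - cenMap c) (ξ - cenShuf c) k * dispN (U - cenMap c) (ξ - cenShuf c) l) =
        ∑ l ∈ range 9, ((∑ b ∈ (nearA c (trackW aP w)).toFinset, (if k < 6 ∧ l < 6 then ((deriv (deriv (effPot w₄₅ ω₄ (3 / 400))) ‖cenMap c (latPt (1 : E3 →L[ℝ] E3) hexFrame b)‖ - deriv (effPot w₄₅ ω₄ (3 / 400)) ‖cenMap c (latPt (1 : E3 →L[ℝ] E3) hexFrame b)‖ / ‖cenMap c (latPt (1 : E3 →L[ℝ] E3) hexFrame b)‖) / ‖cenMap c (latPt (1 : E3 →L[ℝ] E3) hexFrame b)‖ ^ 2 * (zetaN (cenMap c) (latPt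 (1 : E3 →L[ℝ] E3) hexFrame b) k * zetaN (cenMap c) (latPt (1 : E3 →L[ℝ] E3) hexFrame b) l) + deriv (effPot w₄₅ ω₄ (3 / 400)) ‖cenMap c (latPt (1 : E3 →L[ℝ] E3) hexFrame b)‖ / ‖cenMap c (latPt (1 : E3 →L[ℝ] E3) hexFrame b)‖ * nuR (cenMap c) (latPt (1 : E3 →L[ℝ] E3) hexFrame b) k l) else 0)) + ∑ b ∈ (nearB c (trackW aP w)).toFinset, ((deriv (deriv (effPot w₄₅ ω₄ (3 / 400))) ‖cenMap c (latPt (1 : E3 →L[ℝ] E3) hexFrame b + (hcpShift + cenShuf c))‖ - deriv (effPot w₄₅ ω₄ (3 / 400)) ‖cenMap c (latPt (1 : E3 →L[ℝ] E3) hexFrame b + (hcpShift + cenShuf c))‖ / ‖cenMap c (latPt (1 : E3 →L[ℝ] E3) hexFrame b + (hcpShift + cenShuf c))‖) / ‖cenMap c (latPt (1 : E3 →L[ℝ] E3) hexFrame b + (hcpShift + cenShuf c))‖ ^ 2 * (zetaN (cenMap c) (latPt (1 : E3 →L[ℝ] E3) hexFrame b + (hcpShift + cenShuf c)) k * zetaN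 (cenMap c) (latPt (1 : E3 →L[ℝ] E3) hexFrame b + (hcpShift + cenShuf c)) l) + deriv (effPot w₄₅ ω₄ (3 / 400)) ‖cenMap c (latPt (1 : E3 →L[ℝ] E3) hexFrame b + (hcpShift + cenShuf c))‖ / ‖cenMap c (latPt (1 : E3 →L[ℝ] E3) hexFrame b + (hcpShift + cenShuf c))‖ * nuR (cenMap c) (latPt (1 : E3 →L[ℝ] E3) hexFrame b + (hcpShift + cenShuf c)) k l)) * (dispN (U - cenMap c) (ξ - cenShuf c) k * dispN (U - cenMap c) (ξ - cenShuf c) l) := fun k _ => by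
      rw [Finset.sum_comm (s := (nearA c (trackW aP w)).toFinset) (t := range 9), Finset.sum_comm (s := (nearB c (trackW aP w)).toFinset) (t := range 9),
        ← Finset.sum_add_distrib]
      exact Finset.sum_congr rfl fun l _ => by rw [add_mul, Finset.sum_mul, Finset.sum_mul]
    rw [Finset.sum_congr rfl e3]
    rw [quad_graph (fun k l => ((∑ b ∈ (nearA c (trackW aP w)).toFinset, (if k < 6 ∧ l < 6 then ((deriv (deriv (effPot w₄₅ ω₄ (3 / 400))) ‖cenMap c (latPt (1 : E3 →L[ℝ] E3) hexFrame b)‖ - deriv (effPot w₄₅ ω₄ (3 / 400)) ‖cenMap c (latPt (1 : E3 →L[ℝ] E3) hexFrame b)‖ / ‖cenMap c (latPt (1 : E3 →L[ℝ] E3) hexFrame b)‖) / ‖cenMap c (latPt (1 : E3 →L[ℝ] E3) hexFrame b)‖ ^ 2 * (zetaN (cenMap c) (latPt (1 : E3 →L[ℝ] E3) hexFrame b) k * zetaN (cenMap c) (latPt (1 : E3 →L[ℝ] E3) hexFrame b) l) + deriv (effPot w₄₅ ω₄ (3 / 400)) ‖cenMap c (latPt (1 : E3 →L[ℝ] E3)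 hexFrame b)‖ / ‖cenMap c (latPt (1 : E3 →L[ℝ] E3) hexFrame b)‖ * nuR (cenMap c) (latPt (1 : E3 →L[ℝ] E3) hexFrame b) k l) else 0)) + ∑ b ∈ (nearB c (trackW aP w)).toFinset, ((deriv (deriv (effPot w₄₅ ω₄ (3 / 400))) ‖cenMap c (latPt (1 : E3 →L[ℝ] E3) hexFrame b + (hcpShift + cenShuf c))‖ - deriv (effPot w₄₅ ω₄ (3 / 400)) ‖cenMap c (latPt (1 : E3 →L[ℝ] E3) hexFrame b + (hcpShift + cenShuf c))‖ / ‖cenMap c (latPt (1 : E3 →L[ℝ] E3) hexFrame b + (hcpShift + cenShuf c))‖) / ‖cenMap c (latPt (1 : E3 →L[ℝ] E3) hexFrame b + (hcpShift + cenShuf c))‖ ^ 2 * (zetaN (cenMap c) (latPt (1 : E3 →L[ℝ] E3) hexFrame b + (hcpShift + cenShuf c)) k * zetaN (cenMap c) (latPt (1 : E3 →L[ℝ] E3) hexFrame b + (hcpShift + cenShuf c)) l) + deriv (effPot w₄₅ ω₄ (3 / 400)) ‖cenMap c (latPt (1 : E3 →L[ℝ] E3) hexFrame b + (hcpShift + cenShuf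 c))‖ / ‖cenMap c (latPt (1 : E3 →L[ℝ] E3) hexFrame b + (hcpShift + cenShuf c))‖ * nuR (cenMap c) (latPt (1 : E3 →L[ℝ] E3) hexFrame b + (hcpShift + cenShuf c)) k l))) (dispN (U - cenMap c) (ξ - cenShuf c)) A hgraph]
    -- `δ_e δ_e'` for `e, e' < 6` are `x_e x_e'`; extend to `9 × 9` with the masked table
    have key := sum_quad_bound (fun k l => if k < 6 then (if l < 6 then
        (List.range 3).foldl (fun s m => (List.range 3).foldl (fun s2 m' => s2 + (A m k * A m' l) * (fun k l => ((∑ b ∈ (nearA c (trackW aP w)).toFinset, (if k < 6 ∧ l < 6 then ((deriv (deriv (effPot w₄₅ ω₄ (3 / 400))) ‖cenMap c (latPt (1 : E3 →L[ℝ] E3) hexFrame b)‖ - deriv (effPot w₄₅ ω₄ (3 / 400)) ‖cenMap c (latPt (1 : E3 →L[ℝ] E3) hexFrame b)‖ / ‖cenMap c (latPt (1 : E3 →L[ℝ] E3) hexFrame b)‖) / ‖cenMap c (latPt (1 : E3 →L[ℝ] E3) hexFrame b)‖ ^ 2 * (zetaN (cenMap c) (latPt (1 : E3 →L[ℝ]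 E3) hexFrame b) k * zetaN (cenMap c) (latPt (1 : E3 →L[ℝ] E3) hexFrame b) l) + deriv (effPot w₄₅ ω₄ (3 / 400)) ‖cenMap c (latPt (1 : E3 →L[ℝ] E3) hexFrame b)‖ / ‖cenMap c (latPt (1 : E3 →L[ℝ] E3) hexFrame b)‖ * nuR (cenMap c) (latPt (1 : E3 →L[ℝ] E3) hexFrame b) k l) else 0)) + ∑ b ∈ (nearB c (trackW aP w)).toFinset, ((deriv (deriv (effPot w₄₅ ω₄ (3 / 400))) ‖cenMap c (latPt (1 : E3 →L[ℝ] E3) hexFrame b + (hcpShift + cenShuf c))‖ - deriv (effPot w₄₅ ω₄ (3 / 400)) ‖cenMap c (latPt (1 : E3 →L[ℝ] E3) hexFrame b + (hcpShift + cenShuf c))‖ / ‖cenMap c (latPt (1 : E3 →L[ℝ] E3) hexFrame b + (hcpShift + cenShuf c))‖) / ‖cenMap c (latPt (1 : E3 →L[ℝ] E3) hexFrame b + (hcpShift + cenShuf c))‖ ^ 2 * (zetaN (cenMap c) (latPt (1 : E3 →L[ℝ] E3) hexFrame b + (hcpShift + cenShuf c)) k * zetaN (cenMap c) (latPt (1 :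 E3 →L[ℝ] E3) hexFrame b + (hcpShift + cenShuf c)) l) + deriv (effPot w₄₅ ω₄ (3 / 400)) ‖cenMap c (latPt (1 : E3 →L[ℝ] E3) hexFrame b + (hcpShift + cenShuf c))‖ / ‖cenMap c (latPt (1 : E3 →L[ℝ] E3) hexFrame b + (hcpShift + cenShuf c))‖ * nuR (cenMap c) (latPt (1 : E3 →L[ℝ] E3) hexFrame b + (hcpShift + cenShuf c)) k l))) (6 + m) (6 + m'))
          (s + (fun k l => ((∑ b ∈ (nearA c (trackW aP w)).toFinset, (if k < 6 ∧ l < 6 then ((deriv (deriv (effPot w₄₅ ω₄ (3 / 400))) ‖cenMap c (latPt (1 : E3 →L[ℝ] E3) hexFrame b)‖ - deriv (effPot w₄₅ ω₄ (3 / 400)) ‖cenMap c (latPt (1 : E3 →L[ℝ] E3) hexFrame b)‖ / ‖cenMap c (latPt (1 : E3 →L[ℝ] E3) hexFrame b)‖) / ‖cenMap c (latPt (1 : E3 →L[ℝ] E3) hexFrame b)‖ ^ 2 * (zetaN (cenMap c) (latPt (1 : E3 →L[ℝ] E3) hexFrame b) k * zetaN (cenMap c) (latPt (1 : E3 →L[ℝ]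 E3) hexFrame b) l) + deriv (effPot w₄₅ ω₄ (3 / 400)) ‖cenMap c (latPt (1 : E3 →L[ℝ] E3) hexFrame b)‖ / ‖cenMap c (latPt (1 : E3 →L[ℝ] E3) hexFrame b)‖ * nuR (cenMap c) (latPt (1 : E3 →L[ℝ] E3) hexFrame b) k l) else 0)) + ∑ b ∈ (nearB c (trackW aP w)).toFinset, ((deriv (deriv (effPot w₄₅ ω₄ (3 / 400))) ‖cenMap c (latPt (1 : E3 →L[ℝ] E3) hexFrame b + (hcpShift + cenShuf c))‖ - deriv (effPot w₄₅ ω₄ (3 / 400)) ‖cenMap c (latPt (1 : E3 →L[ℝ] E3) hexFrame b + (hcpShift + cenShuf c))‖ / ‖cenMap c (latPt (1 : E3 →L[ℝ] E3) hexFrame b + (hcpShift + cenShuf c))‖) / ‖cenMap c (latPt (1 : E3 →L[ℝ] E3) hexFrame b + (hcpShift + cenShuf c))‖ ^ 2 * (zetaN (cenMap c) (latPt (1 : E3 →L[ℝ] E3) hexFrame b + (hcpShift + cenShuf c)) k * zetaN (cenMap c) (latPt (1 : E3 →L[ℝ] E3) hexFrame b + (hcpShift + cenShuf c)) l) + deriv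 (effPot w₄₅ ω₄ (3 / 400)) ‖cenMap c (latPt (1 : E3 →L[ℝ] E3) hexFrame b + (hcpShift + cenShuf c))‖ / ‖cenMap c (latPt (1 : E3 →L[ℝ] E3) hexFrame b + (hcpShift + cenShuf c))‖ * nuR (cenMap c) (latPt (1 : E3 →L[ℝ] E3) hexFrame b + (hcpShift + cenShuf c)) k l))) k (6 + m) * A m l + A m k * (fun k l => ((∑ b ∈ (nearA c (trackW aP w)).toFinset, (if k < 6 ∧ l < 6 then ((deriv (deriv (effPot w₄₅ ω₄ (3 / 400))) ‖cenMap c (latPt (1 : E3 →L[ℝ] E3) hexFrame b)‖ - deriv (effPot w₄₅ ω₄ (3 / 400)) ‖cenMap c (latPt (1 : E3 →L[ℝ] E3) hexFrame b)‖ / ‖cenMap c (latPt (1 : E3 →L[ℝ] E3) hexFrame b)‖) / ‖cenMap c (latPt (1 : E3 →L[ℝ] E3) hexFrame b)‖ ^ 2 * (zetaN (cenMap c) (latPt (1 : E3 →L[ℝ] E3) hexFrame b) k * zetaN (cenMap c) (latPt (1 : E3 →L[ℝ] E3) hexFrame b) l) + deriv (effPot w₄₅ ω₄ (3 / 400)) ‖cenMap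 c (latPt (1 : E3 →L[ℝ] E3) hexFrame b)‖ / ‖cenMap c (latPt (1 : E3 →L[ℝ] E3) hexFrame b)‖ * nuR (cenMap c) (latPt (1 : E3 →L[ℝ] E3) hexFrame b) k l) else 0)) + ∑ b ∈ (nearB c (trackW aP w)).toFinset, ((deriv (deriv (effPot w₄₅ ω₄ (3 / 400))) ‖cenMap c (latPt (1 : E3 →L[ℝ] E3) hexFrame b + (hcpShift + cenShuf c))‖ - deriv (effPot w₄₅ ω₄ (3 / 400)) ‖cenMap c (latPt (1 : E3 →L[ℝ] E3) hexFrame b + (hcpShift + cenShuf c))‖ / ‖cenMap c (latPt (1 : E3 →L[ℝ] E3) hexFrame b + (hcpShift + cenShuf c))‖) / ‖cenMap c (latPt (1 : E3 →L[ℝ] E3) hexFrame b + (hcpShift + cenShuf c))‖ ^ 2 * (zetaN (cenMap c) (latPt (1 : E3 →L[ℝ] E3) hexFrame b + (hcpShift + cenShuf c)) k * zetaN (cenMap c) (latPt (1 : E3 →L[ℝ] E3) hexFrame b + (hcpShift + cenShuf c)) l) + deriv (effPot w₄₅ ω₄ (3 / 400)) ‖cenMap c (latPt (1 : E3 →L[ℝ]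 E3) hexFrame b + (hcpShift + cenShuf c))‖ / ‖cenMap c (latPt (1 : E3 →L[ℝ] E3) hexFrame b + (hcpShift + cenShuf c))‖ * nuR (cenMap c) (latPt (1 : E3 →L[ℝ] E3) hexFrame b + (hcpShift + cenShuf c)) k l))) (6 + m) l)) ((fun k l => ((∑ b ∈ (nearA c (trackW aP w)).toFinset, (if k < 6 ∧ l < 6 then ((deriv (deriv (effPot w₄₅ ω₄ (3 / 400))) ‖cenMap c (latPt (1 : E3 →L[ℝ] E3) hexFrame b)‖ - deriv (effPot w₄₅ ω₄ (3 / 400)) ‖cenMap c (latPt (1 : E3 →L[ℝ] E3) hexFrame b)‖ / ‖cenMap c (latPt (1 : E3 →L[ℝ] E3) hexFrame b)‖) / ‖cenMap c (latPt (1 : E3 →L[ℝ] E3) hexFrame b)‖ ^ 2 * (zetaN (cenMap c) (latPt (1 : E3 →L[ℝ] E3) hexFrame b) k * zetaN (cenMap c) (latPt (1 : E3 →L[ℝ] E3) hexFrame b) l) + deriv (effPot w₄₅ ω₄ (3 / 400)) ‖cenMap c (latPt (1 : E3 →L[ℝ] E3) hexFrame b)‖ / ‖cenMap c (latPt (1 :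 E3 →L[ℝ] E3) hexFrame b)‖ * nuR (cenMap c) (latPt (1 : E3 →L[ℝ] E3) hexFrame b) k l) else 0)) + ∑ b ∈ (nearB c (trackW aP w)).toFinset, ((deriv (deriv (effPot w₄₅ ω₄ (3 / 400))) ‖cenMap c (latPt (1 : E3 →L[ℝ] E3) hexFrame b + (hcpShift + cenShuf c))‖ - deriv (effPot w₄₅ ω₄ (3 / 400)) ‖cenMap c (latPt (1 : E3 →L[ℝ] E3) hexFrame b + (hcpShift + cenShuf c))‖ / ‖cenMap c (latPt (1 : E3 →L[ℝ] E3) hexFrame b + (hcpShift + cenShuf c))‖) / ‖cenMap c (latPt (1 : E3 →L[ℝ] E3) hexFrame b + (hcpShift + cenShuf c))‖ ^ 2 * (zetaN (cenMap c) (latPt (1 : E3 →L[ℝ] E3) hexFrame b + (hcpShift + cenShuf c)) k * zetaN (cenMap c) (latPt (1 : E3 →L[ℝ] E3) hexFrame b + (hcpShift + cenShuf c)) l) + deriv (effPot w₄₅ ω₄ (3 / 400)) ‖cenMap c (latPt (1 : E3 →L[ℝ] E3) hexFrame b + (hcpShift + cenShuf c))‖ / ‖cenMap c (latPt (1 : E3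 →L[ℝ] E3) hexFrame b + (hcpShift + cenShuf c))‖ * nuR (cenMap c) (latPt (1 : E3 →L[ℝ] E3) hexFrame b + (hcpShift + cenShuf c)) k l))) k l)
        else 0) else 0) (dispN (U - cenMap c) 0) (fun k l => (hessTrack aP (passP c (nearA c (trackW aP w)) (nearB c (trackW aP w))).H).getD (9 * k + l) fi0) (fun k l hk hl => by
        by_cases hk6 : k < 6
        · by_cases hl6 : l < 6
          · rw [if_pos hk6, if_pos hl6]
            have hh := mem_hessTrack aP (passP c (nearA c (trackW aP w)) (nearB c (trackW aP w))).H (fun k l => ((∑ b ∈ (nearA c (trackW aP w)).toFinset, (if k < 6 ∧ l < 6 then ((deriv (deriv (effPot w₄₅ ω₄ (3 / 400))) ‖cenMap c (latPt (1 : E3 →L[ℝ] E3) hexFrame b)‖ - deriv (effPot w₄₅ ω₄ (3 / 400)) ‖cenMap c (latPt (1 : E3 →L[ℝ] E3) hexFrame b)‖ / ‖cenMap c (latPt (1 : E3 →L[ℝ] E3) hexFrame b)‖) / ‖cenMap c (latPt (1 : E3 →L[ℝ] E3) hexFrame b)‖ ^ 2 * (zetaN (cenMap c) (latPt (1 : E3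 →L[ℝ] E3) hexFrame b) k * zetaN (cenMap c) (latPt (1 : E3 →L[ℝ] E3) hexFrame b) l) + deriv (effPot w₄₅ ω₄ (3 / 400)) ‖cenMap c (latPt (1 : E3 →L[ℝ] E3) hexFrame b)‖ / ‖cenMap c (latPt (1 : E3 →L[ℝ] E3) hexFrame b)‖ * nuR (cenMap c) (latPt (1 : E3 →L[ℝ] E3) hexFrame b) k l) else 0)) + ∑ b ∈ (nearB c (trackW aP w)).toFinset, ((deriv (deriv (effPot w₄₅ ω₄ (3 / 400))) ‖cenMap c (latPt (1 : E3 →L[ℝ] E3) hexFrame b + (hcpShift + cenShuf c))‖ - deriv (effPot w₄₅ ω₄ (3 / 400)) ‖cenMap c (latPt (1 : E3 →L[ℝ] E3) hexFrame b + (hcpShift + cenShuf c))‖ / ‖cenMap c (latPt (1 : E3 →L[ℝ] E3) hexFrame b + (hcpShift + cenShuf c))‖) / ‖cenMap c (latPt (1 : E3 →L[ℝ] E3) hexFrame b + (hcpShift + cenShuf c))‖ ^ 2 * (zetaN (cenMap c) (latPt (1 : E3 →L[ℝ] E3) hexFrame b + (hcpShift + cenShuf c)) k * zetaN (cenMap c)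 (latPt (1 : E3 →L[ℝ] E3) hexFrame b + (hcpShift + cenShuf c)) l) + deriv (effPot w₄₅ ω₄ (3 / 400)) ‖cenMap c (latPt (1 : E3 →L[ℝ] E3) hexFrame b + (hcpShift + cenShuf c))‖ / ‖cenMap c (latPt (1 : E3 →L[ℝ] E3) hexFrame b + (hcpShift + cenShuf c))‖ * nuR (cenMap c) (latPt (1 : E3 →L[ℝ] E3) hexFrame b + (hcpShift + cenShuf c)) k l))) hmemH hk6 hl6
            simp only [hA, dif_pos hk6, dif_pos hl6]
            exact hh
          · rw [if_pos hk6, if_neg hl6, hessTrack_masked aP _ hk hl (Or.inr (not_lt.1 hl6))]; exact mem_fi0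
        · rw [if_neg hk6, hessTrack_masked aP _ hk hl (Or.inl (not_lt.1 hk6))]; exact mem_fi0)
    refine key.trans (le_of_eq ?_)
    exact sum99_dite_eq (U - cenMap c) (ξ - cenShuf c) _
  -- (4) the certified box minimum (six variables: `x = dispN ΔU 0`, widths `wfU`)
  have hbm := boxMin_le ((hessTrack aP (passP c (nearA c (trackW aP w)) (nearB c (trackW aP w))).H).map cen) ((gradTrack aP (passP c (nearA c (trackW aP w)) (nearB c (trackW aP w))).g).map cen) (wfU (Array.ofFn fun p : Fin 9 => foldW (trackW aP w) p)) (anchor ((hessTrack aP (passP c (nearA c (trackW aP w)) (nearB c (trackW aP w))).H).map cen) ((gradTrack aP (passP c (nearA c (trackW aP w)) (nearB c (trackW aP w))).g).map cen) (wfU (Array.ofFn fun p : Fin 9 => foldW (trackW aP w) p)) 40) κ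
    (sym_of_symOK hsymOK) (psd_of_kappaShift hκ) (dispN (U - cenMap c) 0) hx
  simp only [get81, getD_map_cen] at hbm
  -- (5) the point-width penalties
  have hr1 : ∀ k, k < 9 → 0 ≤ rad ((gradTrack aP (passP c (nearA c (trackW aP w)) (nearB c (trackW aP w))).g).getD k fi0) := by
    intro k hk
    by_cases hk6 : k < 6
    · exact rad_nonneg (mem_gradTrack aP (passP c (nearA c (trackW aP w)) (nearB c (trackW aP w))).g _ hmem hk6)
    · rw [gradTrack_ge6 aP _ (not_lt.1 hk6) hk]; exact (cen_fi0).2.ge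
  have hr2 : ∀ k l, k < 9 → l < 9 → 0 ≤ rad ((hessTrack aP (passP c (nearA c (trackW aP w)) (nearB c (trackW aP w))).H).getD (9 * k + l) fi0) := by
    intro k l hk hl
    by_cases hkl : k < 6 ∧ l < 6
    · exact rad_nonneg (mem_hessTrack aP (passP c (nearA c (trackW aP w)) (nearB c (trackW aP w))).H _ hmemH hkl.1 hkl.2)
    · rw [hessTrack_masked aP _ hk hl (by omega)]; exact (cen_fi0).2.ge
  have hpen1 := pen1_bound (fun k => rad ((gradTrack aP (passP c (nearA c (trackW aP w)) (nearB c (trackW aP w))).g).getD k fi0)) (fun k => (wfU (Array.ofFn fun p : Fin 9 => foldW (trackW aP w) p)).getD k 0) (dispN (U - cenMap c) 0) hr1 hx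
  have hpen2 := pen2_bound (fun k l => rad ((hessTrack aP (passP c (nearA c (trackW aP w)) (nearB c (trackW aP w))).H).getD (9 * k + l) fi0)) (fun k => (wfU (Array.ofFn fun p : Fin 9 => foldW (trackW aP w) p)).getD k 0) (dispN (U - cenMap c) 0) hr2 hx
  -- the kit's folds are these sums
  have ec1 : ((List.range 9).foldl (fun s k => s + ((gradTrack aP (passP c (nearA c (trackW aP w)) (nearB c (trackW aP w))).g).map rad).getD k 0 * (wfU (Array.ofFn fun p : Fin 9 => foldW (trackW aP w) p)).getD k 0) 0) = (∑ k ∈ range 9, rad ((gradTrack aP (passP c (nearA c (trackW aP w)) (nearB c (trackW aP w))).g).getD k fi0) * (wfU (Array.ofFn fun p : Fin 9 => foldW (trackW aP w) p)).getD k 0) := by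
    rw [foldl9_sum]; simp only [getD_map_rad]
  have ec2 : ((List.range 9).foldl (fun s k => (List.range 9).foldl (fun s2 l => s2 + (((hessTrack aP (passP c (nearA c (trackW aP w)) (nearB c (trackW aP w))).H).map rad).getD (9 * k + l) 0) * (wfU (Array.ofFn fun p : Fin 9 => foldW (trackW aP w) p)).getD k 0 * (wfU (Array.ofFn fun p : Fin 9 => foldW (trackW aP w) p)).getD l 0) s) 0) = (∑ k ∈ range 9, ∑ l ∈ range 9, rad ((hessTrack aP (passP c (nearA c (trackW aP w)) (nearB c (trackW aP w))).H).getD (9 * k + l) fi0) * (wfU (Array.ofFn fun p : Fin 9 => foldW (trackW aP w) p)).getD k 0 * (wfU (Array.ofFn fun p : Fin 9 => foldW (trackW aP w) p)).getD l 0) := by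
    rw [foldl99_sum]; simp only [getD_map_rad]
  have ec1R : (((∑ k ∈ range 9, rad ((gradTrack aP (passP c (nearA c (trackW aP w)) (nearB c (trackW aP w))).g).getD k fi0) * (wfU (Array.ofFn fun p : Fin 9 => foldW (trackW aP w) p)).getD k 0) : ℤ) : ℝ) = ((((List.range 9).foldl (fun s k => s + ((gradTrack aP (passP c (nearA c (trackW aP w)) (nearB c (trackW aP w))).g).map rad).getD k 0 * (wfU (Array.ofFn fun p : Fin 9 => foldW (trackW aP w) p)).getD k 0) 0) : ℤ) : ℝ) := by rw [ec1]
  have ec2R : (((∑ k ∈ range 9, ∑ l ∈ range 9, rad ((hessTrack aP (passP c (nearA c (trackW aP w)) (nearB c (trackW aP w))).H).getD (9 * k + l) fi0) * (wfU (Array.ofFn fun p : Fin 9 => foldW (trackW aP w) p)).getD k 0 * (wfU (Array.ofFn fun p : Fin 9 => foldW (trackW aP w) p)).getD l 0) : ℤ) : ℝ) = ((((List.range 9).foldl (fun s k => (List.range 9).foldl (fun s2 l => s2 + (((hessTrack aP (passP c (nearA c (trackW aP w)) (nearB c (trackW aP w))).H).map rad).getD (9 * k + l) 0) * (wfU (Array.ofFn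 fun p : Fin 9 => foldW (trackW aP w) p)).getD k 0 * (wfU (Array.ofFn fun p : Fin 9 => foldW (trackW aP w) p)).getD l 0) s) 0) : ℤ) : ℝ) := by rw [ec2]
  have hc1 := div_le_cdiv (a := ((List.range 9).foldl (fun s k => s + ((gradTrack aP (passP c (nearA c (trackW aP w)) (nearB c (trackW aP w))).g).map rad).getD k 0 * (wfU (Array.ofFn fun p : Fin 9 => foldW (trackW aP w) p)).getD k 0) 0)) (b := (SC : ℤ)) SCZ_pos
  have hc2 := div_le_cdiv (a := ((List.range 9).foldl (fun s k => (List.range 9).foldl (fun s2 l => s2 + (((hessTrack aP (passP c (nearA c (trackW aP w)) (nearB c (trackW aP w))).H).map rad).getD (9 * k + l) 0) * (wfU (Array.ofFn fun p : Fin 9 => foldW (trackW aP w) p)).getD k 0 * (wfU (Array.ofFn fun p : Fin 9 => foldW (trackW aP w) p)).getD l 0) s) 0)) (b := 2 * (SC : ℤ) * (SC : ℤ)) (mul_pos (mul_pos (by norm_num) SCZ_pos) SCZ_pos)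
  have hc3 := div_le_cdiv (a := (passJ c (trackW aP w) (Array.ofFn fun p : Fin 9 => foldW (trackW aP w) p) (nearA c (trackW aP w)) (nearB c (trackW aP w))).pen6) (b := 6 * (SC : ℤ) * (SC : ℤ)) (mul_pos (mul_pos (by norm_num) SCZ_pos) SCZ_pos)
  have hc4 := div_le_cdiv (a := (passJ c (trackW aP w) (Array.ofFn fun p : Fin 9 => foldW (trackW aP w) p) (nearA c (trackW aP w)) (nearB c (trackW aP w))).pen0) (b := 2 * (SC : ℤ) * (SC : ℤ)) (mul_pos (mul_pos (by norm_num) SCZ_pos) SCZ_pos)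
  -- (6) `pen0` / `pen6` as the sums of the per-label contributions
  have ep0 : (passJ c (trackW aP w) (Array.ofFn fun p : Fin 9 => foldW (trackW aP w) p) (nearA c (trackW aP w)) (nearB c (trackW aP w))).pen0 = (∑ b ∈ (nearA c (trackW aP w)).toFinset, (accLabel wJ (fun a b : ℕ => decide (a < 6 ∧ b < 6)) (Array.ofFn fun p : Fin 9 => foldW (trackW aP w) p) (RbA b) (hessOf (RpA b) true) true ⟨true, 0, 0⟩).pen0) + ∑ b ∈ (nearB c (trackW aP w)).toFinset, (accLabel wJ (fun _ _ : ℕ => true) (Array.ofFn fun p : Fin 9 => foldW (trackW aP w) p) (RbB b) (hessOf (RpB b) false) false ⟨true, 0, 0⟩).pen0 := by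
    rw [hpen0, List.sum_toFinset _ (nearA_nodup c (trackW aP w)), List.sum_toFinset _ (nearB_nodup c (trackW aP w))]
    exact congrArg₂ (· + ·) (congrArg List.sum (List.map_congr_left fun b hb => by simp only [hRbA b hb, hRpA b hb]))
      (congrArg List.sum (List.map_congr_left fun b hb => by simp only [hRbB b hb, hRpB b hb]))
  have ep6 : (passJ c (trackW aP w) (Array.ofFn fun p : Fin 9 => foldW (trackW aP w) p) (nearA c (trackW aP w)) (nearB c (trackW aP w))).pen6 = (∑ b ∈ (nearA c (trackW aP w)).toFinset, (accLabel wJ (fun a b : ℕ => decide (a < 6 ∧ b < 6)) (Array.ofFn fun p : Fin 9 => foldW (trackW aP w) p) (RbA b) (hessOf (RpA b) true) true ⟨true, 0, 0⟩).pen6) + ∑ b ∈ (nearB c (trackW aP w)).toFinset, (accLabel wJ (fun _ _ : ℕ => true) (Array.ofFn fun p : Fin 9 => foldW (trackW aP w) p) (RbB b) (hessOf (RpB b) false) false ⟨true, 0, 0⟩).pen6 := by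
    rw [hpen6, List.sum_toFinset _ (nearA_nodup c (trackW aP w)), List.sum_toFinset _ (nearB_nodup c (trackW aP w))]
    exact congrArg₂ (· + ·) (congrArg List.sum (List.map_congr_left fun b hb => by simp only [hRbA b hb, hRpA b hb]))
      (congrArg List.sum (List.map_congr_left fun b hb => by simp only [hRbB b hb, hRpB b hb]))
  have ep0R : (((passJ c (trackW aP w) (Array.ofFn fun p : Fin 9 => foldW (trackW aP w) p) (nearA c (trackW aP w)) (nearB c (trackW aP w))).pen0 : ℤ) : ℝ) = (∑ b ∈ (nearA c (trackW aP w)).toFinset, (((accLabel wJ (fun a b : ℕ => decide (a < 6 ∧ b < 6)) (Array.ofFn fun p : Fin 9 => foldW (trackW aP w) p) (RbA b) (hessOf (RpA b) true) true ⟨true, 0, 0⟩).pen0 : ℤ) : ℝ)) + ∑ b ∈ (nearB c (trackW aP w)).toFinset, (((accLabel wJ (fun _ _ : ℕ => true) (Array.ofFn fun p : Fin 9 => foldW (trackW aP w) p) (RbB b) (hessOf (RpB b) false) false ⟨true, 0, 0⟩).pen0 : ℤ) : ℝ) := by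
    rw [ep0]; push_cast; rfl
  have ep6R : (((passJ c (trackW aP w) (Array.ofFn fun p : Fin 9 => foldW (trackW aP w) p) (nearA c (trackW aP w)) (nearB c (trackW aP w))).pen6 : ℤ) : ℝ) = (∑ b ∈ (nearA c (trackW aP w)).toFinset, (((accLabel wJ (fun a b : ℕ => decide (a < 6 ∧ b < 6)) (Array.ofFn fun p : Fin 9 => foldW (trackW aP w) p) (RbA b) (hessOf (RpA b) true) true ⟨true, 0, 0⟩).pen6 : ℤ) : ℝ)) + ∑ b ∈ (nearB c (trackW aP w)).toFinset, (((accLabel wJ (fun _ _ : ℕ => true) (Array.ofFn fun p : Fin 9 => foldW (trackW aP w) p) (RbB b) (hessOf (RpB b) false) false ⟨true, 0, 0⟩).pen6 : ℤ) : ℝ) := by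
    rw [ep6]; push_cast; rfl
  -- the charge sums in closed form
  have eQA : (∑ b ∈ (nearA c (trackW aP w)).toFinset, 1 / 2 * (((accLabel wJ (fun a b : ℕ => decide (a < 6 ∧ b < 6)) (Array.ofFn fun p : Fin 9 => foldW (trackW aP w) p) (RbA b) (hessOf (RpA b) true) true ⟨true, 0, 0⟩).pen0 : ℤ) : ℝ) / ((SC : ℝ) * SC * SC)) +
      ∑ b ∈ (nearA c (trackW aP w)).toFinset, 1 / 6 * ((((accLabel wJ (fun a b : ℕ => decide (a < 6 ∧ b < 6)) (Array.ofFn fun p : Fin 9 => foldW (trackW aP w) p) (RbA b) (hessOf (RpA b) true) true ⟨true, 0, 0⟩).pen6 : ℤ) : ℝ) + 729 * SC) / ((SC : ℝ) * SC * SC) =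
      1 / 2 * (∑ b ∈ (nearA c (trackW aP w)).toFinset, (((accLabel wJ (fun a b : ℕ => decide (a < 6 ∧ b < 6)) (Array.ofFn fun p : Fin 9 => foldW (trackW aP w) p) (RbA b) (hessOf (RpA b) true) true ⟨true, 0, 0⟩).pen0 : ℤ) : ℝ)) / ((SC : ℝ) * SC * SC) +
        1 / 6 * ((∑ b ∈ (nearA c (trackW aP w)).toFinset, (((accLabel wJ (fun a b : ℕ => decide (a < 6 ∧ b < 6)) (Array.ofFn fun p : Fin 9 => foldW (trackW aP w) p) (RbA b) (hessOf (RpA b) true) true ⟨true, 0, 0⟩).pen6 : ℤ) : ℝ)) + ((nearA c (trackW aP w)).toFinset.card : ℕ) * (729 * SC)) / ((SC : ℝ) * SC * SC) := by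
    rw [← Finset.sum_div, ← Finset.sum_div, ← Finset.mul_sum, ← Finset.mul_sum, Finset.sum_add_distrib, Finset.sum_const, nsmul_eq_mul]
  have eQB : (∑ b ∈ (nearB c (trackW aP w)).toFinset, 1 / 2 * (((accLabel wJ (fun _ _ : ℕ => true) (Array.ofFn fun p : Fin 9 => foldW (trackW aP w) p) (RbB b) (hessOf (RpB b) false) false ⟨true, 0, 0⟩).pen0 : ℤ) : ℝ) / ((SC : ℝ) * SC * SC)) +
      ∑ b ∈ (nearB c (trackW aP w)).toFinset, 1 / 6 * ((((accLabel wJ (fun _ _ : ℕ => true) (Array.ofFn fun p : Fin 9 => foldW (trackW aP w) p) (RbB b) (hessOf (RpB b) false) false ⟨true, 0, 0⟩).pen6 : ℤ) : ℝ) + 729 * SC) / ((SC : ℝ) * SC * SC) =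
      1 / 2 * (∑ b ∈ (nearB c (trackW aP w)).toFinset, (((accLabel wJ (fun _ _ : ℕ => true) (Array.ofFn fun p : Fin 9 => foldW (trackW aP w) p) (RbB b) (hessOf (RpB b) false) false ⟨true, 0, 0⟩).pen0 : ℤ) : ℝ)) / ((SC : ℝ) * SC * SC) +
        1 / 6 * ((∑ b ∈ (nearB c (trackW aP w)).toFinset, (((accLabel wJ (fun _ _ : ℕ => true) (Array.ofFn fun p : Fin 9 => foldW (trackW aP w) p) (RbB b) (hessOf (RpB b) false) false ⟨true, 0, 0⟩).pen6 : ℤ) : ℝ)) + ((nearB c (trackW aP w)).toFinset.card : ℕ) * (729 * SC)) / ((SC : ℝ) * SC * SC) := by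
    rw [← Finset.sum_div, ← Finset.sum_div, ← Finset.mul_sum, ← Finset.mul_sum, Finset.sum_add_distrib, Finset.sum_const, nsmul_eq_mul]
  rw [eQA] at hsumA
  rw [eQB] at hsumB
  -- (7) everything over `ℝ`
  push_cast at hc1 hc2 hc3 hc4
  have hineqR : (0 : ℝ) ≤ ((v : ℝ) + ((boxMin ((hessTrack aP (passP c (nearA c (trackW aP w)) (nearB c (trackW aP w))).H).map cen) ((gradTrack aP (passP c (nearA c (trackW aP w)) (nearB c (trackW aP w))).g).map cen) (wfU (Array.ofFn fun p : Fin 9 => foldW (trackW aP w) p)) κ (anchor ((hessTrack aP (passP c (nearA c (trackW aP w)) (nearB c (trackW aP w))).H).map cen) ((gradTrack aP (passP c (nearA c (trackW aP w)) (nearB c (trackW aP w))).g).map cen) (wfU (Array.ofFn fun p : Fin 9 => foldW (trackW aP w) p)) 40) : ℤ) : ℝ) - ((((cdiv ((List.range 9).foldl (fun s k => s + ((gradTrack aP (passP c (nearA c (trackW aP w)) (nearB c (trackW aP w))).g).map rad).getD k 0 * (wfU (Array.ofFn fun p : Fin 9 => foldW (trackW aP w) p)).getD k 0) 0) (SC :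 ℤ) : ℤ) : ℝ)) + ((cdiv ((List.range 9).foldl (fun s k => (List.range 9).foldl (fun s2 l => s2 + (((hessTrack aP (passP c (nearA c (trackW aP w)) (nearB c (trackW aP w))).H).map rad).getD (9 * k + l) 0) * (wfU (Array.ofFn fun p : Fin 9 => foldW (trackW aP w) p)).getD k 0 * (wfU (Array.ofFn fun p : Fin 9 => foldW (trackW aP w) p)).getD l 0) s) 0) (2 * (SC : ℤ) * (SC : ℤ)) : ℤ) : ℝ)) - ((cdiv (passJ c (trackW aP w) (Array.ofFn fun p : Fin 9 => foldW (trackW aP w) p) (nearA c (trackW aP w)) (nearB c (trackW aP w))).pen6 (6 * (SC : ℤ) * (SC : ℤ)) : ℤ) : ℝ) - ((cdiv (passJ c (trackW aP w) (Array.ofFn fun p : Fin 9 => foldW (trackW aP w) p) (nearA c (trackW aP w)) (nearB c (trackW aP w))).pen0 (2 * (SC : ℤ) * (SC : ℤ)) : ℤ) : ℝ) - (μ : ℝ)) := by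
    exact_mod_cast hineq
  have hN1 := (div_le_iff₀ hS).1 hc1
  have hN2 := (div_le_iff₀ (mul_pos (mul_pos (by norm_num) hS) hS : (0 : ℝ) < 2 * (SC : ℝ) * SC)).1 hc2
  have hN6 := (div_le_iff₀ (mul_pos (mul_pos (by norm_num) hS) hS : (0 : ℝ) < 6 * (SC : ℝ) * SC)).1 hc3
  have hN0 := (div_le_iff₀ (mul_pos (mul_pos (by norm_num) hS) hS : (0 : ℝ) < 2 * (SC : ℝ) * SC)).1 hc4
  have hpen1' : ∑ k ∈ range 9, ((rad ((gradTrack aP (passP c (nearA c (trackW aP w)) (nearB c (trackW aP w))).g).getD k fi0) : ℝ) / SC) * |dispN (U - cenMap c) 0 k| ≤ ((cdiv ((List.range 9).foldl (fun s k => s + ((gradTrack aP (passP c (nearA c (trackW aP w)) (nearB c (trackW aP w))).g).map rad).getD k 0 * (wfU (Array.ofFn fun p : Fin 9 => foldW (trackW aP w) p)).getD k 0) 0) (SC : ℤ) : ℤ) : ℝ) / SC := by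
    refine hpen1.trans ?_
    rw [ec1R, div_le_div_iff₀ (mul_pos hS hS) hS]
    linarith [mul_le_mul_of_nonneg_right hN1 hS.le]
  have hpen2' : ∑ k ∈ range 9, ∑ l ∈ range 9, ((rad ((hessTrack aP (passP c (nearA c (trackW aP w)) (nearB c (trackW aP w))).H).getD (9 * k + l) fi0) : ℝ) / SC) * (|dispN (U - cenMap c) 0 k| * |dispN (U - cenMap c) 0 l|) ≤
      2 * ((cdiv ((List.range 9).foldl (fun s k => (List.range 9).foldl (fun s2 l => s2 + (((hessTrack aP (passP c (nearA c (trackW aP w)) (nearB c (trackW aP w))).H).map rad).getD (9 * k + l) 0) * (wfU (Array.ofFn fun p : Fin 9 => foldW (trackW aP w) p)).getD k 0 * (wfU (Array.ofFn fun p : Fin 9 => foldW (trackW aP w) p)).getD l 0) s) 0) (2 * (SC : ℤ) * (SC : ℤ)) : ℤ) : ℝ) / SC := by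
    refine hpen2.trans ?_
    rw [ec2R, div_le_div_iff₀ hS3 hS]
    linarith [mul_le_mul_of_nonneg_right hN2 hS.le]
  have hQ0 : 1 / 2 * (∑ b ∈ (nearA c (trackW aP w)).toFinset, (((accLabel wJ (fun a b : ℕ => decide (a < 6 ∧ b < 6)) (Array.ofFn fun p : Fin 9 => foldW (trackW aP w) p) (RbA b) (hessOf (RpA b) true) true ⟨true, 0, 0⟩).pen0 : ℤ) : ℝ)) / ((SC : ℝ) * SC * SC) + 1 / 2 * (∑ b ∈ (nearB c (trackW aP w)).toFinset, (((accLabel wJ (fun _ _ : ℕ => true) (Array.ofFn fun p : Fin 9 => foldW (trackW aP w) p) (RbB b) (hessOf (RpB b) false) false ⟨true, 0, 0⟩).pen0 : ℤ) : ℝ)) / ((SC : ℝ) * SC * SC) ≤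
      ((cdiv (passJ c (trackW aP w) (Array.ofFn fun p : Fin 9 => foldW (trackW aP w) p) (nearA c (trackW aP w)) (nearB c (trackW aP w))).pen0 (2 * (SC : ℤ) * (SC : ℤ)) : ℤ) : ℝ) / SC := by
    rw [← add_div, ← mul_add, ← ep0R, div_le_div_iff₀ hS3 hS]
    linarith [mul_le_mul_of_nonneg_right hN0 hS.le]
  have hQ6 : 1 / 6 * ((∑ b ∈ (nearA c (trackW aP w)).toFinset, (((accLabel wJ (fun a b : ℕ => decide (a < 6 ∧ b < 6)) (Array.ofFn fun p : Fin 9 => foldW (trackW aP w) p) (RbA b) (hessOf (RpA b) true) true ⟨true, 0, 0⟩).pen6 : ℤ) : ℝ)) + ((nearA c (trackW aP w)).toFinset.card : ℕ) * (729 * SC)) / ((SC : ℝ) * SC * SC) +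
      1 / 6 * ((∑ b ∈ (nearB c (trackW aP w)).toFinset, (((accLabel wJ (fun _ _ : ℕ => true) (Array.ofFn fun p : Fin 9 => foldW (trackW aP w) p) (RbB b) (hessOf (RpB b) false) false ⟨true, 0, 0⟩).pen6 : ℤ) : ℝ)) + ((nearB c (trackW aP w)).toFinset.card : ℕ) * (729 * SC)) / ((SC : ℝ) * SC * SC) ≤
      ((cdiv (passJ c (trackW aP w) (Array.ofFn fun p : Fin 9 => foldW (trackW aP w) p) (nearA c (trackW aP w)) (nearB c (trackW aP w))).pen6 (6 * (SC : ℤ) * (SC : ℤ)) : ℤ) : ℝ) / SC + 1 / SC := by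
    rw [← add_div, ← mul_add, ← add_div, div_le_div_iff₀ hS3 hS]
    have hcards := cards729_le c (trackW aP w)
    have h6 := mul_le_mul_of_nonneg_right hN6 hS.le
    have hc' := mul_le_mul_of_nonneg_right hcards hS.le
    rw [ep6R] at h6
    linarith [h6, hc']
  -- (8) combine
  have e1 : ((μ : ℝ) - 1) / SC = (μ : ℝ) / SC - 1 / SC := by ring
  have e2 : ((v : ℝ) + ((boxMin ((hessTrack aP (passP c (nearA c (trackW aP w)) (nearB c (trackW aP w))).H).map cen) ((gradTrack aP (passP c (nearA c (trackW aP w)) (nearB c (trackW aP w))).g).map cen) (wfU (Array.ofFn fun p : Fin 9 => foldW (trackW aP w) p)) κ (anchor ((hessTrack aP (passP c (nearA c (trackW aP w)) (nearB c (trackW aP w))).H).map cen) ((gradTrack aP (passP c (nearA c (trackW aP w)) (nearB c (trackW aP w))).g).map cen) (wfU (Array.ofFn fun p : Fin 9 => foldW (trackW aP w) p)) 40) : ℤ) : ℝ) - ((((cdiv ((List.range 9).foldl (fun s k => s + ((gradTrack aP (passP c (nearA c (trackW aP w)) (nearB c (trackW aP w))).g).map rad).getD k 0 * (wfU (Array.ofFn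 fun p : Fin 9 => foldW (trackW aP w) p)).getD k 0) 0) (SC : ℤ) : ℤ) : ℝ)) + ((cdiv ((List.range 9).foldl (fun s k => (List.range 9).foldl (fun s2 l => s2 + (((hessTrack aP (passP c (nearA c (trackW aP w)) (nearB c (trackW aP w))).H).map rad).getD (9 * k + l) 0) * (wfU (Array.ofFn fun p : Fin 9 => foldW (trackW aP w) p)).getD k 0 * (wfU (Array.ofFn fun p : Fin 9 => foldW (trackW aP w) p)).getD l 0) s) 0) (2 * (SC : ℤ) * (SC : ℤ)) : ℤ) : ℝ)) - ((cdiv (passJ c (trackW aP w) (Array.ofFn fun p : Fin 9 => foldW (trackW aP w) p) (nearA c (trackW aP w)) (nearB c (trackW aP w))).pen6 (6 * (SC : ℤ) * (SC : ℤ)) : ℤ) : ℝ) - ((cdiv (passJ c (trackW aP w) (Array.ofFn fun p : Fin 9 => foldW (trackW aP w) p) (nearA c (trackW aP w)) (nearB c (trackW aP w))).pen0 (2 * (SC : ℤ) * (SC : ℤ)) : ℤ) : ℝ) - (μ : ℝ)) / SC =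
      (v : ℝ) / SC + ((boxMin ((hessTrack aP (passP c (nearA c (trackW aP w)) (nearB c (trackW aP w))).H).map cen) ((gradTrack aP (passP c (nearA c (trackW aP w)) (nearB c (trackW aP w))).g).map cen) (wfU (Array.ofFn fun p : Fin 9 => foldW (trackW aP w) p)) κ (anchor ((hessTrack aP (passP c (nearA c (trackW aP w)) (nearB c (trackW aP w))).H).map cen) ((gradTrack aP (passP c (nearA c (trackW aP w)) (nearB c (trackW aP w))).g).map cen) (wfU (Array.ofFn fun p : Fin 9 => foldW (trackW aP w) p)) 40) : ℤ) : ℝ) / SC - ((cdiv ((List.range 9).foldl (fun s k => s + ((gradTrack aP (passP c (nearA c (trackW aP w)) (nearB c (trackW aP w))).g).map rad).getD k 0 * (wfU (Array.ofFn fun p : Fin 9 => foldW (trackW aP w) p)).getD k 0) 0) (SC : ℤ) : ℤ) : ℝ) / SC - ((cdiv ((List.range 9).foldl (fun s k => (List.range 9).foldl (fun s2 l => s2 + (((hessTrack aP (passP c (nearA c (trackW aP w)) (nearB c (trackW aP w))).H).map rad).getD (9 * k + l) 0) * (wfU (Array.ofFn fun p : Fin 9 => foldW (trackW aP w) p)).getD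 k 0 * (wfU (Array.ofFn fun p : Fin 9 => foldW (trackW aP w) p)).getD l 0) s) 0) (2 * (SC : ℤ) * (SC : ℤ)) : ℤ) : ℝ) / SC - ((cdiv (passJ c (trackW aP w) (Array.ofFn fun p : Fin 9 => foldW (trackW aP w) p) (nearA c (trackW aP w)) (nearB c (trackW aP w))).pen6 (6 * (SC : ℤ) * (SC : ℤ)) : ℤ) : ℝ) / SC - ((cdiv (passJ c (trackW aP w) (Array.ofFn fun p : Fin 9 => foldW (trackW aP w) p) (nearA c (trackW aP w)) (nearB c (trackW aP w))).pen0 (2 * (SC : ℤ) * (SC : ℤ)) : ℤ) : ℝ) / SC -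
        (μ : ℝ) / SC := by ring
  have hineqR' := div_nonneg hineqR hS.le
  rw [e2] at hineqR'
  have e3 : 2 * ((cdiv ((List.range 9).foldl (fun s k => (List.range 9).foldl (fun s2 l => s2 + (((hessTrack aP (passP c (nearA c (trackW aP w)) (nearB c (trackW aP w))).H).map rad).getD (9 * k + l) 0) * (wfU (Array.ofFn fun p : Fin 9 => foldW (trackW aP w) p)).getD k 0 * (wfU (Array.ofFn fun p : Fin 9 => foldW (trackW aP w) p)).getD l 0) s) 0) (2 * (SC : ℤ) * (SC : ℤ)) : ℤ) : ℝ) / SC = 2 * (((cdiv ((List.range 9).foldl (fun s k => (List.range 9).foldl (fun s2 l => s2 + (((hessTrack aP (passP c (nearA c (trackW aP w)) (nearB c (trackW aP w))).H).map rad).getD (9 * k + l) 0) * (wfU (Array.ofFn fun p : Fin 9 => foldW (trackW aP w) p)).getD k 0 * (wfU (Array.ofFn fun p : Fin 9 => foldW (trackW aP w) p)).getD l 0) s) 0) (2 * (SC : ℤ) * (SC : ℤ)) : ℤ) : ℝ) / SC) := by ring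
  rw [e3] at hpen2'
  rw [e1]
  linarith [hsumA, hsumB, hT1, hlin, hquad, hbm, hpen1', hpen2', hQ0, hQ6, hineqR']

end Summit.AtomisticToContinuum.Crystallization.Theorems.FrustratedLawDichotomyStrainedPatchHomValueT2Kit
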